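import Summits.QuantumFields.YangMills.Theorems.BalabanUVNodesN06AtOpsYOfLettersAllPins
import Summits.QuantumFields.YangMills.Theorems.BalabanUVNodesN06AtRecord11ObligationsPins8
import Literature.MathematicalPhysics.QuantumFieldTheory.Balaban1983to89.B9Ineq343GpAtLetters
import Literature.MathematicalPhysics.QuantumFieldTheory.Balaban1983to89.B9RowSum261DefiniteFaces
import Literature.MathematicalPhysics.QuantumFieldTheory.Balaban1983to89.B9Ineq347GAAtLetters
import Literature.MathematicalPhysics.QuantumFieldTheory.Balaban1983to89.B9Thm314WholePairWalks
import Literature.MathematicalPhysics.QuantumFieldTheory.Balaban1983to89.B9Thm314WholePinGeometry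

/-!
# BalabanUVNodes ∕ N06 ([B9], `Dag.B9_main`) — THE WHOLE STAGE-11 CERTIFICATE AT def-Y's INSTANCE ON THE ALL-BLOCKS PINS, IV: ROWS 18–19 WITH NO DISPLAYED RESIDUAL (n06-k), ROW 13 IN
# POSITIVE-INPUT STEP CURRENCY (n06-c's frame interface), ROWS 22–23 ON PER-SEQUENCE WALK SETS (n06-m g3)

Track A of `YM-PLAN.md` (cell `pub-ymgap`, D-0062), node **N06** = [Balaban1985BackgroundPropagators] Thms 3.1–3.15; seat `pub-ymgap-dag-n06-d` gen 3 = N06-ASSIGNMENT v1 (P3).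
Sequel of `…N06AtOpsYOfLettersAllPinsC` (p479933, the «N06 WHOLE-STATEMENT MODULE» of director №117 (B)): the ORIGINAL certificate `…N06AtRecord11CB10YZW.b9_main_of_up_view₁₁B10YZW_of_obligations`
(p449575) at `ops := opsYOfLetters N θ M⋆ 𝔏 𝔈`, all 28 operator-layer binders supplied by lemma, every landed supplier consumed BY NAME as in `…AllPinsC` (row 12 n06-h `hGA_opsYOfLetters`; row 11 n06-h
`hGp_opsYOfLetters_of_leaves5`; rows 15–16 n06-j `t39_hksum_of_pin_rowConst261`), with THREE CHANGES.  (i) ROWS 18–19 `t37`, `t310` = `…ObligationsPins8.t37_of_allPin_complete` ∕ `t310_of_allPin_complete`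
on n06-k's `B9RWSums346TwoGp∕…346Two.…_allPin_complete` (over `…344Input(Gp)` ∕ `…346Lap` ∕ `…343Holder(Gp)` ∕ `…346Schur`): EVERY member of the typed (3.42)–(3.47) block for `(ops x).Gp` ∕ `(ops x).GA`
read from the random-walk sums (3.90) ∕ (3.107) is PROVED inside the leaves — the residual binders `hrest hrestA har harA` are GONE; rows 18–19 rest on the walk pins `𝔬 rd 𝔬310 rd310` with
n06-c's ∕ n06-k's packages, the Cor-3.6-type operator packages `h36H h36H3` (Hölder legs ∧ V-terms∕probe-read factors ∧ Laplacian legs ∧ input legs ∧ input-read factors ∧ two-sided L² legs ∧ L²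
factors — POSITED schemas of printed shape through the probe letters `𝔭 𝔭3` of (3.40) and the input letters `bH bH3`), the co-readings of def-Y's kernel-family letters (`CoRealizes`, `GlobReads`,
`L2Reads` n = 0…5, `H1Reads`, `InputReads`, transpose letters), member facts, supports∕counts, constants' relations, and the E-letter pins.  (ii) ROW 13 `hB` = n06-c's
`B9SectBStepWhole.sectBStepPrinted_of_posBlockSteps` GIVEN Theorems 3.2∕3.3 at the instance (`h32` from rows 15–16, `h33` = `B9.thm33_of_thm37_310` from rows 18–19 + `hsum`): the fourteen Sect.-B
binders are now the WEAKER positive-input steps `StepEPos ∕ StepL2nPos ∕ StepGlobPos ∕ StepH1Pos ∕ StepE4Pos ∕ StepH2Pos ∕ StepKerPos` and the two one-family halves `StepAnalyticPos1` (the shape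
n06-c g3's frames `B9SectBGStepAtLetters.stepEPos_of_gFrame` … produce; every `Step` is a `StepPos`, `stepPos_of_step`).  (iii) ROWS 22–23 `⟨t314, t314loc⟩` = n06-m g3's
`B9Thm314WholePairWalks.thm314_pair_of_pair_walks` + `locDataY_laws`: the pair's walk sets are CONSTRUCTED (`pairWalkSets`) from per-sequence `W₁ W₂` with `WalkSetsSpec` ∕ `WalkWeightsSummable` per
sequence (row-18 shape).  HONEST FRAMING.  def-Y's layer of LETTERS (U = 1 clauses), not Bałaban's constructed operators (def-Y v2 `lettersYOfRecord` re-instantiates `𝔏` by unification); every row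
supplied MODULO displayed hypothesis schemas of printed ∕ located shape; nothing of [B9] proved for Bałaban's operators; N06 NOT discharged; count-neutral.  One finite 𝕋⁴ programme at fixed `ε` —
NOT ℝ⁴ ∕ OS ∕ mass gap ∕ Clay.  0 `def`, 0 `sorry`.
-/








noncomputable section

namespace Summit.QuantumFields.YangMills.BalabanUVNodes.N06AtOpsYOfLettersAllPinsD

open Literature.MathematicalPhysics.QuantumFieldTheory.Balaban1983to89
open Literature.MathematicalPhysics.QuantumFieldTheory.Balaban1983to89.T4Continuum (T4Family)
open Literature.MathematicalPhysics.QuantumFieldTheory.Balaban1983to89.DagBinding (WorldP leavesP)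
open Literature.MathematicalPhysics.QuantumFieldTheory.Balaban1983to89.Node00
open Literature.MathematicalPhysics.QuantumFieldTheory.Balaban1983to89.B9PinMembersKLevelV1 (MemberY geo9Y bg9Y)
open Literature.MathematicalPhysics.QuantumFieldTheory.Balaban1983to89.B9PinGeometryKLevelV1 (dOmegaY OmKY inΛY unitDistY c35Y c35Y_pos kLab dOmegaY_nonneg)
open Literature.MathematicalPhysics.QuantumFieldTheory.Balaban1983to89.B9Thm314GpFlatTorusGeometry (tdistK OmegaC)
open Literature.MathematicalPhysics.QuantumFieldTheory.Balaban1983to89.B9Thm314WholePair (pairExpansion pairTermK locData₂)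
open Literature.MathematicalPhysics.QuantumFieldTheory.Balaban1983to89.B9Thm314WholePairWalks (pairWalkSets thm314_pair_of_pair_walks)
open Literature.MathematicalPhysics.QuantumFieldTheory.Balaban1983to89.B9Thm314WholePinGeometry (locDataY locDataY_laws)
open Literature.MathematicalPhysics.QuantumFieldTheory.Balaban1983to89.B9Thm314WholeSummation (WalkSetsSpec WalkWeightsSummable DominatedBySums)
open Literature.MathematicalPhysics.QuantumFieldTheory.Balaban1983to89.B9SectCWalkTermsAllNorms (Thm310AllNormsPrinted)
open Literature.MathematicalPhysics.QuantumFieldTheory.Balaban1983to89.B9Ineq347GAAtLetters (hGA_opsYOfLetters)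
open Literature.MathematicalPhysics.QuantumFieldTheory.Balaban1983to89.B7Prop2SpecialUnitary (specialUnitaryUnits)
open Literature.MathematicalPhysics.QuantumFieldTheory.Balaban1983to89.B9Thm37Whole (Ops Sizes StaticOK Local342 Identities const37)
open Literature.MathematicalPhysics.QuantumFieldTheory.Balaban1983to89.B9Cor38Whole (WalkReading Locality W38OfOps)
open Literature.MathematicalPhysics.QuantumFieldTheory.Balaban1983to89.B9Thm37GlueCor36 (CoRealizes)
open Literature.MathematicalPhysics.QuantumFieldTheory.Balaban1983to89.B6RandomWalk (Ineq261)
open Literature.MathematicalPhysics.QuantumFieldTheory.Balaban1983to89.B9Thm34Ext (toB6)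
open Literature.MathematicalPhysics.QuantumFieldTheory.Balaban1983to89.B9SectBStepWhole
  (StepEPos StepL2nPos StepGlobPos StepH1Pos StepE4Pos StepH2Pos StepKerPos StepAnalyticPos1 stepAnalyticPos_of_halves stepL2Pos_of_members sectBStepPrinted_of_posBlockSteps)
open Literature.MathematicalPhysics.QuantumFieldTheory.Balaban1983to89.B9Ineq349Whole (Dict349)
open Literature.MathematicalPhysics.QuantumFieldTheory.Balaban1983to89.B9Eq3132Whole (CTInputs InvNormalised WeightsTransfer)
open Literature.MathematicalPhysics.QuantumFieldTheory.Balaban1983to89.B9ResidualEntriesAtOne (AtOneL2nOn AtOneE4On AtOneH2On)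
open Literature.MathematicalPhysics.QuantumFieldTheory.Balaban1983to89.B9Thm39Whole
  (Ops39 WalkReading39 EK39OfOps StaticOK39 Local348 Identities395 Small285 Factors389 Locality39 KerReads)
open Literature.MathematicalPhysics.QuantumFieldTheory.Balaban1983to89.B9Thm311Whole (Ops311 PosDefOfOps Inputs311)
open Literature.MathematicalPhysics.QuantumFieldTheory.Balaban1983to89.B9Thm310Whole
  (Ops310 WalkReading310 Sizes310 StaticOK310 Locality310 Local342G Identities310 W310OfOps)
open Literature.MathematicalPhysics.QuantumFieldTheory.Balaban1983to89.B9Thm315Whole (Ops315 Reads315 Static315 GivenBy3185OfOps HasRWExpCOfOps)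
open Literature.MathematicalPhysics.QuantumFieldTheory.Balaban1983to89.B9GeoLemma21KLevelV1
  (distOK_geo9Y levelGap_geo9Y_one rowSum261_geo9Y geo9Y_dist_triangle geo9Y_dist_comm geo9Y_len_pos)
open Literature.MathematicalPhysics.QuantumFieldTheory.Balaban1983to89.B9GeoNormsKLevelModelSignsV1 (modelSignsOn_geo9K)
open Summit.QuantumFields.YangMills.BalabanUVNodes.N06AtRecord11ObligationsPins (t311_of_pin t315_of_pins)
open Literature.MathematicalPhysics.QuantumFieldTheory.Balaban1983to89.B9Cor35ComparisonsGAAtLetters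
  (hGA_e_opsYOfLetters hGA_h1_opsYOfLetters hGA_e4_opsYOfLetters hGA_h2_opsYOfLetters hGA_l2_opsYOfLetters)
open Literature.MathematicalPhysics.QuantumFieldTheory.Balaban1983to89.B9Cor35ComparisonsGpCAtLetters (hGp_e_opsYOfLetters hGp_h1_opsYOfLetters hC_opsYOfLetters)
open Summit.QuantumFields.YangMills.BalabanUVNodes.N06AtRecord11ObligationsPins2 (s3132_of_inputs)
open Literature.MathematicalPhysics.QuantumFieldTheory.Balaban1983to89.B9RowSum261DefiniteFaces (rowConst261 t39_hksum_of_pin_rowConst261)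
open Literature.MathematicalPhysics.QuantumFieldTheory.Balaban1983to89.B9Thm312Whole (GeoOK Thm33G0 FormSmall HasRWExpOfOps HasRWExpHOfOps PosDefKOfOps)
open Literature.MathematicalPhysics.QuantumFieldTheory.Balaban1983to89.B11SectG (RowSum)
open Literature.MathematicalPhysics.QuantumFieldTheory.Balaban1983to89.B9FromB6 (L2Block)
open Literature.MathematicalPhysics.QuantumFieldTheory.Balaban1983to89.B9Thm37GlueCor36 (Clause342)
open Literature.MathematicalPhysics.QuantumFieldTheory.Balaban1983to89.B9Thm312WholeLeaf (thm312Printed_of_step)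
open Literature.MathematicalPhysics.QuantumFieldTheory.Balaban1983to89.B9Thm313Whole (Letters313 thm313Printed_of_step)
open Literature.MathematicalPhysics.QuantumFieldTheory.Balaban1983to89.B9GeoNormsKLevelV1 (geo9K_dist_nonneg)
open Literature.MathematicalPhysics.QuantumFieldTheory.Balaban1983to89.B9Thm37Glue (IsTransposePair)
open Literature.MathematicalPhysics.QuantumFieldTheory.Balaban1983to89.B9RWSums343to347Whole (GlobReads Facts347 ConvAll3107 E37AllOfOps)
open Literature.MathematicalPhysics.QuantumFieldTheory.Balaban1983to89.B9RWSums346Schur (L2Reads)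
open Literature.MathematicalPhysics.QuantumFieldTheory.Balaban1983to89.B9Cor35ComparisonsEH (hE4_of_hGA_e4 hH2_of_hGA_h2)
open Literature.MathematicalPhysics.QuantumFieldTheory.Balaban1983to89.B9Ineq349Whole (stmt349Printed_of_thm31_thm32)
open Summit.QuantumFields.YangMills.BalabanUVNodes.N06AtRecord11ObligationsHg (hg_obligation_vacuous)
open Summit.QuantumFields.YangMills.BalabanUVNodes.N06AtRecord11ObligationsPins4 (c38_of_allPin hsum_of_allPins)
open Summit.QuantumFields.YangMills.BalabanUVNodes.N06AtRecord11ObligationsPins8 (t37_of_allPin_complete t310_of_allPin_complete)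
open Literature.MathematicalPhysics.QuantumFieldTheory.Balaban1983to89.B9RWSums346Two (L2TwoLegs310 FactorsL2_310 twoConst)
open Literature.MathematicalPhysics.QuantumFieldTheory.Balaban1983to89.B9RWSums346TwoGp (L2TwoLegs37 FactorsL2_37)
open Literature.MathematicalPhysics.QuantumFieldTheory.Balaban1983to89.B9RWSums344Input (InputReads InputLegs310 FactorsInput310 inputConst44 inputConst45)
open Literature.MathematicalPhysics.QuantumFieldTheory.Balaban1983to89.B9RWSums344InputGp (InputLegs37 FactorsInput37)
open Literature.MathematicalPhysics.QuantumFieldTheory.Balaban1983to89.B11SectG (BlockNorm)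
open Literature.MathematicalPhysics.QuantumFieldTheory.Balaban1983to89.B9RWSums343Holder (HolderProbes H1Reads HolderLegs310 FactorsHolder310 holderConst)
open Literature.MathematicalPhysics.QuantumFieldTheory.Balaban1983to89.B9RWSums343HolderGp (HolderLegs37 HolderV37)
open Literature.MathematicalPhysics.QuantumFieldTheory.Balaban1983to89.B9RWSums346Lap (LapLegs310 LapLegs37 lapConst)
open Literature.MathematicalPhysics.QuantumFieldTheory.Balaban1983to89.B9Ineq343GpAtLetters (hGp_opsYOfLetters_of_leaves5)
open Summit.QuantumFields.YangMills.BalabanUVNodes.N06AtRecord11CB10YZW (b9_main_of_up_view₁₁B10YZW_of_obligations)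
open scoped Matrix.Norms.L2Operator

variable {N : ℕ}

section Pointed

variable [NeZero N] {F : T4Family}

/-- **THE WHOLE STAGE-11 CERTIFICATE AT def-Y's INSTANCE ON THE ALL-BLOCKS PINS, IV** (module docstring): `Dag.B9_main` at every run of a world bound over the four-pin Stage-11
view of `(θ, M⋆, opsYOfLetters N θ M⋆ 𝔏 𝔈, ζ, λ_W)`, every `𝔏 𝔈`; as `…_allPins_r12pairH` but rows 18–19 by `…Pins8.…_of_allPin_complete` (no residual), row 13 from positive-input steps
given Thms 3.2∕3.3, rows 22–23 on per-sequence walk sets.  NOT a discharge of N06. [cite: Balaban1985BackgroundPropagators, Thms 3.1–3.15 pp.397–432, Thm 3.4 + Sect. B pp.400–407, Cor. 3.6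
p.408, (3.40) p.397, (3.42)–(3.48) pp.397–398, (3.105)–(3.106) p.414, Thm 3.14 p.427, Cor. 3.5 p.407; Balaban1984PropagatorsII, Prop. 2.6 (2.136) p.247, Lemma 2.1 pp.233–234] -/
theorem b9_main_of_up_view₁₁B10YZW_opsYOfLetters_allPins_r12pairI (θ : Stage11Params F N) (hθ : θ.Admissible) (Mstar : ℕ)
    (𝔏 : LettersY N θ.toStage3Params Mstar) (𝔈 : ExpsY N θ.toStage3Params Mstar) (ζ : ResidZ F N) (lamW : ResidW F N) (w : WorldP)
    (hup : ∀ P, w.up P = upOfRecord₅C F N (θ.view₁₁B10YZW F N Mstar (opsYOfLetters N θ.toStage3Params Mstar 𝔏 𝔈) ζ lamW) P)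
    (hAp : StepAnalyticPos1 (θ.d₆ + 1) c35Y geo9Y (bg9Y (Matrix (Fin N) (Fin N) ℂ) (specialUnitaryUnits (Fin N))) (fun x => ((opsYOfLetters N θ.toStage3Params Mstar 𝔏 𝔈) x).Gp) (fun x => ((opsYOfLetters N θ.toStage3Params Mstar 𝔏 𝔈) x).GA) (fun x => ((opsYOfLetters N θ.toStage3Params Mstar 𝔏 𝔈) x).Cinv) (fun x => ((opsYOfLetters N θ.toStage3Params Mstar 𝔏 𝔈) x).IsAnalyticExt) (fun x => ((opsYOfLetters N θ.toStage3Params Mstar 𝔏 𝔈) x).Gp))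
    (hAa : StepAnalyticPos1 (θ.d₆ + 1) c35Y geo9Y (bg9Y (Matrix (Fin N) (Fin N) ℂ) (specialUnitaryUnits (Fin N))) (fun x => ((opsYOfLetters N θ.toStage3Params Mstar 𝔏 𝔈) x).Gp) (fun x => ((opsYOfLetters N θ.toStage3Params Mstar 𝔏 𝔈) x).GA) (fun x => ((opsYOfLetters N θ.toStage3Params Mstar 𝔏 𝔈) x).Cinv) (fun x => ((opsYOfLetters N θ.toStage3Params Mstar 𝔏 𝔈) x).IsAnalyticExt) (fun x => ((opsYOfLetters N θ.toStage3Params Mstar 𝔏 𝔈) x).GA))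
    (hEp : StepEPos (θ.d₆ + 1) c35Y geo9Y (bg9Y (Matrix (Fin N) (Fin N) ℂ) (specialUnitaryUnits (Fin N))) (fun x => ((opsYOfLetters N θ.toStage3Params Mstar 𝔏 𝔈) x).Gp) (fun x => ((opsYOfLetters N θ.toStage3Params Mstar 𝔏 𝔈) x).GA) (fun x => ((opsYOfLetters N θ.toStage3Params Mstar 𝔏 𝔈) x).Cinv) (fun x => ((opsYOfLetters N θ.toStage3Params Mstar 𝔏 𝔈) x).Gp))
    (hLp : ∀ n : Fin 6, StepL2nPos (θ.d₆ + 1) c35Y geo9Y (bg9Y (Matrix (Fin N) (Fin N) ℂ) (specialUnitaryUnits (Fin N))) (fun x => ((opsYOfLetters N θ.toStage3Params Mstar 𝔏 𝔈) x).Gp) (fun x => ((opsYOfLetters N θ.toStage3Params Mstar 𝔏 𝔈) x).GA) (fun x => ((opsYOfLetters N θ.toStage3Params Mstar 𝔏 𝔈) x).Cinv) (fun x => ((opsYOfLetters N θ.toStage3Params Mstar 𝔏 𝔈) x).Gp) n)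
    (hGlp : StepGlobPos (θ.d₆ + 1) c35Y geo9Y (bg9Y (Matrix (Fin N) (Fin N) ℂ) (specialUnitaryUnits (Fin N))) (fun x => ((opsYOfLetters N θ.toStage3Params Mstar 𝔏 𝔈) x).Gp) (fun x => ((opsYOfLetters N θ.toStage3Params Mstar 𝔏 𝔈) x).GA) (fun x => ((opsYOfLetters N θ.toStage3Params Mstar 𝔏 𝔈) x).Cinv) (fun x => ((opsYOfLetters N θ.toStage3Params Mstar 𝔏 𝔈) x).Gp))
    (hH1p : StepH1Pos (θ.d₆ + 1) c35Y geo9Y (bg9Y (Matrix (Fin N) (Fin N) ℂ) (specialUnitaryUnits (Fin N))) (fun x => ((opsYOfLetters N θ.toStage3Params Mstar 𝔏 𝔈) x).Gp) (fun x => ((opsYOfLetters N θ.toStage3Params Mstar 𝔏 𝔈) x).GA) (fun x => ((opsYOfLetters N θ.toStage3Params Mstar 𝔏 𝔈) x).Cinv) (fun x => ((opsYOfLetters N θ.toStage3Params Mstar 𝔏 𝔈) x).Gp))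
    (hE4p : StepE4Pos (θ.d₆ + 1) c35Y geo9Y (bg9Y (Matrix (Fin N) (Fin N) ℂ) (specialUnitaryUnits (Fin N))) (fun x => ((opsYOfLetters N θ.toStage3Params Mstar 𝔏 𝔈) x).Gp) (fun x => ((opsYOfLetters N θ.toStage3Params Mstar 𝔏 𝔈) x).GA) (fun x => ((opsYOfLetters N θ.toStage3Params Mstar 𝔏 𝔈) x).Cinv) (fun x => ((opsYOfLetters N θ.toStage3Params Mstar 𝔏 𝔈) x).Gp))
    (hH2p : StepH2Pos (θ.d₆ + 1) c35Y geo9Y (bg9Y (Matrix (Fin N) (Fin N) ℂ) (specialUnitaryUnits (Fin N))) (fun x => ((opsYOfLetters N θ.toStage3Params Mstar 𝔏 𝔈) x).Gp) (fun x => ((opsYOfLetters N θ.toStage3Params Mstar 𝔏 𝔈) x).GA) (fun x => ((opsYOfLetters N θ.toStage3Params Mstar 𝔏 𝔈) x).Cinv) (fun x => ((opsYOfLetters N θ.toStage3Params Mstar 𝔏 𝔈) x).Gp))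
    (hK : StepKerPos (θ.d₆ + 1) c35Y geo9Y (bg9Y (Matrix (Fin N) (Fin N) ℂ) (specialUnitaryUnits (Fin N))) (fun x => ((opsYOfLetters N θ.toStage3Params Mstar 𝔏 𝔈) x).Gp) (fun x => ((opsYOfLetters N θ.toStage3Params Mstar 𝔏 𝔈) x).GA) (fun x => ((opsYOfLetters N θ.toStage3Params Mstar 𝔏 𝔈) x).Cinv) (fun x => ((opsYOfLetters N θ.toStage3Params Mstar 𝔏 𝔈) x).Cinv))
    (hEa : StepEPos (θ.d₆ + 1) c35Y geo9Y (bg9Y (Matrix (Fin N) (Fin N) ℂ) (specialUnitaryUnits (Fin N))) (fun x => ((opsYOfLetters N θ.toStage3Params Mstar 𝔏 𝔈) x).Gp) (fun x => ((opsYOfLetters N θ.toStage3Params Mstar 𝔏 𝔈) x).GA) (fun x => ((opsYOfLetters N θ.toStage3Params Mstar 𝔏 𝔈) x).Cinv) (fun x => ((opsYOfLetters N θ.toStage3Params Mstar 𝔏 𝔈) x).GA))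
    (hLa : ∀ n : Fin 6, StepL2nPos (θ.d₆ + 1) c35Y geo9Y (bg9Y (Matrix (Fin N) (Fin N) ℂ) (specialUnitaryUnits (Fin N))) (fun x => ((opsYOfLetters N θ.toStage3Params Mstar 𝔏 𝔈) x).Gp) (fun x => ((opsYOfLetters N θ.toStage3Params Mstar 𝔏 𝔈) x).GA) (fun x => ((opsYOfLetters N θ.toStage3Params Mstar 𝔏 𝔈) x).Cinv) (fun x => ((opsYOfLetters N θ.toStage3Params Mstar 𝔏 𝔈) x).GA) n)
    (hGla : StepGlobPos (θ.d₆ + 1) c35Y geo9Y (bg9Y (Matrix (Fin N) (Fin N) ℂ) (specialUnitaryUnits (Fin N))) (fun x => ((opsYOfLetters N θ.toStage3Params Mstar 𝔏 𝔈) x).Gp) (fun x => ((opsYOfLetters N θ.toStage3Params Mstar 𝔏 𝔈) x).GA) (fun x => ((opsYOfLetters N θ.toStage3Params Mstar 𝔏 𝔈) x).Cinv) (fun x => ((opsYOfLetters N θ.toStage3Params Mstar 𝔏 𝔈) x).GA))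
    (hH1a : StepH1Pos (θ.d₆ + 1) c35Y geo9Y (bg9Y (Matrix (Fin N) (Fin N) ℂ) (specialUnitaryUnits (Fin N))) (fun x => ((opsYOfLetters N θ.toStage3Params Mstar 𝔏 𝔈) x).Gp) (fun x => ((opsYOfLetters N θ.toStage3Params Mstar 𝔏 𝔈) x).GA) (fun x => ((opsYOfLetters N θ.toStage3Params Mstar 𝔏 𝔈) x).Cinv) (fun x => ((opsYOfLetters N θ.toStage3Params Mstar 𝔏 𝔈) x).GA))
    (hE4a : StepE4Pos (θ.d₆ + 1) c35Y geo9Y (bg9Y (Matrix (Fin N) (Fin N) ℂ) (specialUnitaryUnits (Fin N))) (fun x => ((opsYOfLetters N θ.toStage3Params Mstar 𝔏 𝔈) x).Gp) (fun x => ((opsYOfLetters N θ.toStage3Params Mstar 𝔏 𝔈) x).GA) (fun x => ((opsYOfLetters N θ.toStage3Params Mstar 𝔏 𝔈) x).Cinv) (fun x => ((opsYOfLetters N θ.toStage3Params Mstar 𝔏 𝔈) x).GA))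
    (hH2a : StepH2Pos (θ.d₆ + 1) c35Y geo9Y (bg9Y (Matrix (Fin N) (Fin N) ℂ) (specialUnitaryUnits (Fin N))) (fun x => ((opsYOfLetters N θ.toStage3Params Mstar 𝔏 𝔈) x).Gp) (fun x => ((opsYOfLetters N θ.toStage3Params Mstar 𝔏 𝔈) x).GA) (fun x => ((opsYOfLetters N θ.toStage3Params Mstar 𝔏 𝔈) x).Cinv) (fun x => ((opsYOfLetters N θ.toStage3Params Mstar 𝔏 𝔈) x).GA))
    [∀ x : MemberY θ.d₆ θ.ℓ₆ θ.hd' θ.hL' θ.b₀ θ.b₁ Mstar, Fintype (geo9Y x).Site] [∀ x : MemberY θ.d₆ θ.ℓ₆ θ.hd' θ.hL' θ.b₀ θ.b₁ Mstar, DecidableEq (geo9Y x).Site]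
    {X Y ι PX PY : MemberY θ.d₆ θ.ℓ₆ θ.hd' θ.hL' θ.b₀ θ.b₁ Mstar → Type} [∀ x, Fintype (X x)] [∀ x, DecidableEq (X x)] [∀ x, Fintype (Y x)] [∀ x, DecidableEq (Y x)]
    [∀ x, Fintype (ι x)] [∀ x, Fintype (PX x)] [∀ x, DecidableEq (PX x)] [∀ x, Fintype (PY x)] [∀ x, DecidableEq (PY x)]
    (hGpL3 : AtOneL2nOn geo9Y (bg9Y (Matrix (Fin N) (Fin N) ℂ) (specialUnitaryUnits (Fin N))) (fun x => ((opsYOfLetters N θ.toStage3Params Mstar 𝔏 𝔈) x).Gp) (fun _ lam => ¬ (lam.isRight = true)) 3)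
    (hGpL4 : AtOneL2nOn geo9Y (bg9Y (Matrix (Fin N) (Fin N) ℂ) (specialUnitaryUnits (Fin N))) (fun x => ((opsYOfLetters N θ.toStage3Params Mstar 𝔏 𝔈) x).Gp) (fun _ lam => ¬ (lam.isRight = true)) 4)
    (hGpL5 : AtOneL2nOn geo9Y (bg9Y (Matrix (Fin N) (Fin N) ℂ) (specialUnitaryUnits (Fin N))) (fun x => ((opsYOfLetters N θ.toStage3Params Mstar 𝔏 𝔈) x).Gp) (fun _ lam => ¬ (lam.isRight = true)) 5)
    (hGpE4 : AtOneE4On geo9Y (bg9Y (Matrix (Fin N) (Fin N) ℂ) (specialUnitaryUnits (Fin N))) (fun x => ((opsYOfLetters N θ.toStage3Params Mstar 𝔏 𝔈) x).Gp) (fun _ lam => ¬ (lam.isRight = true)))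
    (hGpH2 : AtOneH2On geo9Y (bg9Y (Matrix (Fin N) (Fin N) ℂ) (specialUnitaryUnits (Fin N))) (fun x => ((opsYOfLetters N θ.toStage3Params Mstar 𝔏 𝔈) x).Gp) (fun _ lam => ¬ (lam.isRight = true)))
    {ι39 κ39 : MemberY θ.d₆ θ.ℓ₆ θ.hd' θ.hL' θ.b₀ θ.b₁ Mstar → Type} [∀ x, Fintype (ι39 x)]
    (𝔬39 : ∀ x : MemberY θ.d₆ θ.ℓ₆ θ.hd' θ.hL' θ.b₀ θ.b₁ Mstar, Ops39 (geo9Y x) (bg9Y (Matrix (Fin N) (Fin N) ℂ) (specialUnitaryUnits (Fin N)) x) (ι39 x) (κ39 x))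
    (rd39 : ∀ x : MemberY θ.d₆ θ.ℓ₆ θ.hd' θ.hL' θ.b₀ θ.b₁ Mstar, WalkReading39 (bg9Y (Matrix (Fin N) (Fin N) ℂ) (specialUnitaryUnits (Fin N)) x) (ι39 x) (κ39 x))
    (α39 α' r39 δ39 θ39 B39 N39 a39 M39 : ℝ) (h39α : 0 < α39) (h39α1 : α39 < 1) (hα'0 : 0 < α') (hα'1 : α' < 1) (hr39 : 0 < r39) (hrδ39 : r39 ≤ δ39) (hθ39 : 0 ≤ θ39)
    (hB39 : 0 < B39) (hN39 : 0 ≤ N39) (ha39 : 0 < a39) (hM39 : 0 < M39) (hst39 : ∀ x, StaticOK39 (𝔬39 x) N39) (hloc39 : ∀ x, Locality39 (𝔬39 x) (rd39 x))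
    (h39 : ∀ x : MemberY θ.d₆ θ.ℓ₆ θ.hd' θ.hL' θ.b₀ θ.b₁ Mstar, M39 ≤ (geo9Y x).M → ∀ α₀ : ℝ, 0 < α₀ → c35Y * (geo9Y x).M * α₀ ≤ a39 →
      ∀ U : (bg9Y (Matrix (Fin N) (Fin N) ℂ) (specialUnitaryUnits (Fin N)) x).Cfg, (bg9Y (Matrix (Fin N) (Fin N) ℂ) (specialUnitaryUnits (Fin N)) x).Reg335 c35Y α₀ U →
        Local348 (𝔬39 x) (θ.d₆ + 1) B39 δ39 U ∧ Identities395 (𝔬39 x) U ∧ Small285 (𝔬39 x) (θ.d₆ + 1) θ39 r39 U ∧ Factors389 (𝔬39 x) (θ.d₆ + 1) θ39 δ39 U)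
    (hEK39 : ∀ x : MemberY θ.d₆ θ.ℓ₆ θ.hd' θ.hL' θ.b₀ θ.b₁ Mstar, ((opsYOfLetters N θ.toStage3Params Mstar 𝔏 𝔈) x).EK39 = EK39OfOps (𝔬39 x) (rd39 x) (θ.d₆ + 1)
      (2 * (N39 * B39) * rowConst261 (geo9Y (d := θ.d₆) (ℓ := θ.ℓ₆) (hd := θ.hd') (hL := θ.hL') (b₀ := θ.b₀) (b₁ := θ.b₁) (Mstar := Mstar)) (α' * r39)) ((1 - α') * r39))
    (hrdC : ∀ x : MemberY θ.d₆ θ.ℓ₆ θ.hd' θ.hL' θ.b₀ θ.b₁ Mstar, KerReads (𝔬39 x) ((opsYOfLetters N θ.toStage3Params Mstar 𝔏 𝔈) x).Cinv (θ.d₆ + 1))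
    {S32 S32₁ : ∀ x : MemberY θ.d₆ θ.ℓ₆ θ.hd' θ.hL' θ.b₀ θ.b₁ Mstar, (bg9Y (Matrix (Fin N) (Fin N) ℂ) (specialUnitaryUnits (Fin N)) x).Cfg → Matrix (geo9Y x).Site (geo9Y x).Site ℝ}
    {w32 w32₁ : ∀ x : MemberY θ.d₆ θ.ℓ₆ θ.hd' θ.hL' θ.b₀ θ.b₁ Mstar, (geo9Y x).Site → ℝ} (hCT : CTInputs c35Y geo9Y (bg9Y (Matrix (Fin N) (Fin N) ℂ) (specialUnitaryUnits (Fin N))) S32) (hCT₁ : CTInputs c35Y geo9Y (bg9Y (Matrix (Fin N) (Fin N) ℂ) (specialUnitaryUnits (Fin N))) S32₁)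
    (hN32 : ∀ x : MemberY θ.d₆ θ.ℓ₆ θ.hd' θ.hL' θ.b₀ θ.b₁ Mstar, InvNormalised ((opsYOfLetters N θ.toStage3Params Mstar 𝔏 𝔈) x).QGQinv (S32 x) (w32 x)) (hN32₁ : ∀ x : MemberY θ.d₆ θ.ℓ₆ θ.hd' θ.hL' θ.b₀ θ.b₁ Mstar, InvNormalised ((opsYOfLetters N θ.toStage3Params Mstar 𝔏 𝔈) x).QG1Qinv (S32₁ x) (w32₁ x)) {A32 : ℝ} (hA32 : 0 < A32)
    (hwt : ∀ ε : ℝ, 0 < ε → ∃ Mw : ℝ, ∀ x : MemberY θ.d₆ θ.ℓ₆ θ.hd' θ.hL' θ.b₀ θ.b₁ Mstar, Mw ≤ (geo9Y x).M →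
      WeightsTransfer (geo9Y x) (θ.d₆ + 1) (w32 x) ε A32 ∧ WeightsTransfer (geo9Y x) (θ.d₆ + 1) (w32₁ x) ε A32)
    (𝔬 : ∀ x, Ops (geo9Y x) (bg9Y (Matrix (Fin N) (Fin N) ℂ) (specialUnitaryUnits (Fin N)) x) (X x) (Y x) (ι x))
    (rd : ∀ x, WalkReading (geo9Y x) (bg9Y (Matrix (Fin N) (Fin N) ℂ) (specialUnitaryUnits (Fin N)) x) (X x) (ι x))
    (𝔭 : ∀ x : MemberY θ.d₆ θ.ℓ₆ θ.hd' θ.hL' θ.b₀ θ.b₁ Mstar, HolderProbes (geo9Y x) (bg9Y (Matrix (Fin N) (Fin N) ℂ) (specialUnitaryUnits (Fin N)) x) (X x) (Y x) (PX x) (PY x)) (SH SL SI S2 : ∀ x : MemberY θ.d₆ θ.ℓ₆ θ.hd' θ.hL' θ.b₀ θ.b₁ Mstar, ι x → Finset (geo9Y x).Site) (Bl BV BI θI : ℝ → ℝ)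
    (BI2 : ℝ → ℝ → ℝ) (NH NL BL MF NI N2 B2 θ2 : ℝ) (dL : ℕ)
    (R : MemberY θ.d₆ θ.ℓ₆ θ.hd' θ.hL' θ.b₀ θ.b₁ Mstar → ℝ) (H : MemberY θ.d₆ θ.ℓ₆ θ.hd' θ.hL' θ.b₀ θ.b₁ Mstar → Prop)
    (κ : MemberY θ.d₆ θ.ℓ₆ θ.hd' θ.hL' θ.b₀ θ.b₁ Mstar → Sizes) (d : ℕ) (α ρ Nc N' Cℓ K θ₀ B₀ δ₀ a₁ M₁ ML : ℝ)
    (bH : ∀ x : MemberY θ.d₆ θ.ℓ₆ θ.hd' θ.hL' θ.b₀ θ.b₁ Mstar, ℝ → BlockNorm (toB6 (geo9Y x) (R x) (H x)) (Y x → ℝ))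
    (hα : 0 ≤ α) (hα2 : α ≤ 1 / 2) (hN : 0 ≤ Nc) (hN' : 0 ≤ N') (hCℓ : 1 ≤ Cℓ) (hK0 : 0 ≤ K) (hθ₀ : 0 ≤ θ₀) (hB₀ : 0 < B₀) (hδ₀ : 0 < δ₀) (ha₁ : 0 < a₁) (hM₁ : 0 < M₁) (hNH : 0 ≤ NH) (hNL : 0 ≤ NL) (hBL : 0 ≤ BL) (hNI : 0 ≤ NI) (hN2 : 0 ≤ N2) (hB2 : 0 ≤ B2) (hθ2 : 0 ≤ θ2)
    (hst : ∀ x, StaticOK (𝔬 x) ρ Nc N' Cℓ (κ x)) (hκ : ∀ x, (κ x).Bounded K θ₀ Cℓ (geo9Y x).M) (hrd : ∀ x, (rd x).OK (𝔬 x).blk) (hloc : ∀ x, Locality (𝔬 x) (rd x))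
    (h261 : ∀ x, ML ≤ (geo9Y x).M → Ineq261 d (toB6 (geo9Y x) (R x) (H x)) δ₀ α) (h36 : ∀ x, M₁ ≤ (geo9Y x).M → ∀ α₀ : ℝ, 0 < α₀ → c35Y * (geo9Y x).M * α₀ ≤ a₁ →
      ∀ U : (bg9Y (Matrix (Fin N) (Fin N) ℂ) (specialUnitaryUnits (Fin N)) x).Cfg, (bg9Y (Matrix (Fin N) (Fin N) ℂ) (specialUnitaryUnits (Fin N)) x).Reg335 c35Y α₀ U →
          Local342 (𝔬 x) (R x) (H x) B₀ δ₀ U ∧ Identities (𝔬 x) (R x) (H x) U)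
    (h36H : ∀ x, M₁ ≤ (geo9Y x).M → ∀ α₀ : ℝ, 0 < α₀ → c35Y * (geo9Y x).M * α₀ ≤ a₁ → ∀ U : (bg9Y (Matrix (Fin N) (Fin N) ℂ) (specialUnitaryUnits (Fin N)) x).Cfg, (bg9Y (Matrix (Fin N) (Fin N) ℂ) (specialUnitaryUnits (Fin N)) x).Reg335 c35Y α₀ U →
      HolderLegs37 (𝔬 x) (𝔭 x) (R x) (H x) (SH x) Bl δ₀ U ∧ HolderV37 (𝔬 x) (𝔭 x) (R x) (H x) BV δ₀ U ∧ LapLegs37 (𝔬 x) (R x) (H x) (SL x) BL δ₀ U ∧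
        InputLegs37 (𝔬 x) (𝔭 x) (R x) (H x) (bH x) (SI x) BI BI2 δ₀ U ∧ FactorsInput37 (𝔬 x) (R x) (H x) (bH x) θI δ₀ U ∧
        L2TwoLegs37 (𝔬 x) (R x) (H x) (S2 x) B2 δ₀ U ∧ FactorsL2_37 (𝔬 x) (R x) (H x) θ2 δ₀ U)
    (hcntH : ∀ (x : MemberY θ.d₆ θ.ℓ₆ θ.hd' θ.hL' θ.b₀ θ.b₁ Mstar) (a : (geo9Y x).Site), (∑ q, if a ∈ SH x q then (1 : ℝ) else 0) ≤ NH) (hcntL : ∀ (x : MemberY θ.d₆ θ.ℓ₆ θ.hd' θ.hL' θ.b₀ θ.b₁ Mstar) (a : (geo9Y x).Site), (∑ q, if a ∈ SL x q then (1 : ℝ) else 0) ≤ NL)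
    (hcntI : ∀ (x : MemberY θ.d₆ θ.ℓ₆ θ.hd' θ.hL' θ.b₀ θ.b₁ Mstar) (a : (geo9Y x).Site), (∑ q, if a ∈ SI x q then (1 : ℝ) else 0) ≤ NI) (hcnt2 : ∀ (x : MemberY θ.d₆ θ.ℓ₆ θ.hd' θ.hL' θ.b₀ θ.b₁ Mstar) (a : (geo9Y x).Site), (∑ q, if a ∈ S2 x q then (1 : ℝ) else 0) ≤ N2)
    (hBl : ∀ β, 0 ≤ β → β < 1 → 0 ≤ Bl β) (hBV : ∀ β, 0 ≤ β → β < 1 → 0 ≤ BV β) (hBI : ∀ ε, 0 < ε → ε ≤ 1 → 0 ≤ BI ε) (hBI2 : ∀ ε β, 0 < ε → ε ≤ 1 → 0 ≤ β → β < 1 → 0 ≤ BI2 ε β) (hθI : ∀ ε, 0 < ε → 0 ≤ θI ε)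
    (evY : ∀ x : MemberY θ.d₆ θ.ℓ₆ θ.hd' θ.hL' θ.b₀ θ.b₁ Mstar, (geo9Y x).Loc → Y x → ℝ)
    (hco0 : ∀ x U, CoRealizes ((opsYOfLetters N θ.toStage3Params Mstar 𝔏 𝔈) x).Gp 0 U (𝔬 x).blk (𝔬 x).blk (rd x).ev ((𝔬 x).Gp U)) (hco1 : ∀ x U, CoRealizes ((opsYOfLetters N θ.toStage3Params Mstar 𝔏 𝔈) x).Gp 1 U (𝔬 x).blkY (𝔬 x).blk (rd x).ev ((𝔬 x).D U ∘ₗ (𝔬 x).Gp U))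
    (hco2 : ∀ x U, CoRealizes ((opsYOfLetters N θ.toStage3Params Mstar 𝔏 𝔈) x).Gp 2 U (𝔬 x).blk (𝔬 x).blkY (evY x) ((𝔬 x).Gp U ∘ₗ (𝔬 x).Dstar U)) (hco3 : ∀ x U, CoRealizes ((opsYOfLetters N θ.toStage3Params Mstar 𝔏 𝔈) x).Gp 3 U (𝔬 x).blk (𝔬 x).blk (rd x).ev ((𝔬 x).Lap U ∘ₗ (𝔬 x).Gp U))
    {B₁ δ₁ : ℝ} (hB₁ : 0 < B₁) (hδ₁ : 0 < δ₁) {Bβ Bε : ℝ → ℝ} {Bεβ : ℝ → ℝ → ℝ}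
    (hgl0 : ∀ x U, GlobReads ((opsYOfLetters N θ.toStage3Params Mstar 𝔏 𝔈) x).Gp 0 U (𝔬 x).blk (𝔬 x).blk (rd x).ev ((𝔬 x).Gp U)) (hgl1 : ∀ x U, GlobReads ((opsYOfLetters N θ.toStage3Params Mstar 𝔏 𝔈) x).Gp 1 U (𝔬 x).blkY (𝔬 x).blk (rd x).ev ((𝔬 x).D U ∘ₗ (𝔬 x).Gp U))
    (hgl2 : ∀ x U, GlobReads ((opsYOfLetters N θ.toStage3Params Mstar 𝔏 𝔈) x).Gp 2 U (𝔬 x).blk (𝔬 x).blkY (evY x) ((𝔬 x).Gp U ∘ₗ (𝔬 x).Dstar U)) (hgl3 : ∀ x U, GlobReads ((opsYOfLetters N θ.toStage3Params Mstar 𝔏 𝔈) x).Gp 3 U (𝔬 x).blk (𝔬 x).blk (rd x).ev ((𝔬 x).Lap U ∘ₗ (𝔬 x).Gp U))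
    (hl0 : ∀ x U, L2Reads (R := R x) (H := H x) ((opsYOfLetters N θ.toStage3Params Mstar 𝔏 𝔈) x).Gp 0 U (𝔬 x).blk (𝔬 x).blk (rd x).ev ((𝔬 x).Gp U)) (hl1 : ∀ x U, L2Reads (R := R x) (H := H x) ((opsYOfLetters N θ.toStage3Params Mstar 𝔏 𝔈) x).Gp 1 U (𝔬 x).blkY (𝔬 x).blk (rd x).ev ((𝔬 x).D U ∘ₗ (𝔬 x).Gp U))
    (hl2 : ∀ x U, L2Reads (R := R x) (H := H x) ((opsYOfLetters N θ.toStage3Params Mstar 𝔏 𝔈) x).Gp 2 U (𝔬 x).blk (𝔬 x).blkY (evY x) ((𝔬 x).Gp U ∘ₗ (𝔬 x).Dstar U)) (hl3 : ∀ x U, L2Reads (R := R x) (H := H x) ((opsYOfLetters N θ.toStage3Params Mstar 𝔏 𝔈) x).Gp 3 U (𝔬 x).blk (𝔬 x).blk (rd x).ev ((𝔬 x).Lap U ∘ₗ (𝔬 x).Gp U))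
    (hl4 : ∀ x U, L2Reads (R := R x) (H := H x) ((opsYOfLetters N θ.toStage3Params Mstar 𝔏 𝔈) x).Gp 4 U (𝔬 x).blkY (𝔬 x).blkY (evY x) ((𝔬 x).D U ∘ₗ ((𝔬 x).Gp U ∘ₗ (𝔬 x).Dstar U)))
    (hl5 : ∀ x U, L2Reads (R := R x) (H := H x) ((opsYOfLetters N θ.toStage3Params Mstar 𝔏 𝔈) x).Gp 5 U (𝔬 x).blk (𝔬 x).blk (rd x).ev ((𝔬 x).Gp U ∘ₗ (𝔬 x).Lap U))
    (hH1 : ∀ x U, H1Reads ((opsYOfLetters N θ.toStage3Params Mstar 𝔏 𝔈) x).Gp U (𝔭 x) (𝔬 x).blk (𝔬 x).blkY ((rd x).ev) (evY x) ((𝔬 x).D U ∘ₗ (𝔬 x).Gp U) ((𝔬 x).Gp U ∘ₗ (𝔬 x).Dstar U))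
    (hIR : ∀ x U, InputReads ((opsYOfLetters N θ.toStage3Params Mstar 𝔏 𝔈) x).Gp U (𝔭 x) (bH x) (𝔬 x).blkY (evY x) ((𝔬 x).D U ∘ₗ ((𝔬 x).Gp U ∘ₗ (𝔬 x).Dstar U)))
    (hsym : ∀ x U, IsTransposePair ((𝔬 x).Gp U) ((𝔬 x).Gp U)) (htr : ∀ x U, IsTransposePair ((𝔬 x).D U ∘ₗ (𝔬 x).Gp U) ((𝔬 x).Gp U ∘ₗ (𝔬 x).Dstar U)) (hadjL : ∀ x U, IsTransposePair ((𝔬 x).Lap U ∘ₗ (𝔬 x).Gp U) ((𝔬 x).Gp U ∘ₗ (𝔬 x).Lap U))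
    {dF : ℕ} {αF L₀ Mg : ℝ} (hfacts : ∀ x : MemberY θ.d₆ θ.ℓ₆ θ.hd' θ.hL' θ.b₀ θ.b₁ Mstar, Mg ≤ (geo9Y x).M → Facts347 (geo9Y x) (R x) (H x) dF ((1 - 2 * α) * δ₀) αF L₀)
    (hCB : (const37 d δ₀ α ρ B₀ Nc N' Cℓ K) ≤ B₁) (hCL : (const37 d δ₀ α ρ B₀ Nc N' Cℓ K) * L₀ ≤ B₁) (hδ₁le : δ₁ ≤ (1 - 2 * αF) * ((1 - 2 * α) * δ₀)) (hαF : 0 ≤ αF * ((1 - 2 * α) * δ₀)) (hαF2 : αF ≤ 1 / 2)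
    (hCg : (const37 d δ₀ α ρ B₀ Nc N' Cℓ K) * B6.c1 dF ((1 - 2 * α) * δ₀) (1 - αF) * L₀ ^ (4 : ℝ) ≤ B₁)
    (hBβ : ∀ β, 0 ≤ β → β < 1 → holderConst d δ₀ α NH N' (const37 d δ₀ α ρ B₀ Nc N' Cℓ K) (Bl β) (BV β) ≤ Bβ β) (hBL5 : Real.sqrt ((const37 d δ₀ α ρ B₀ Nc N' Cℓ K) * lapConst d δ₀ α NL BL L₀) * L₀ ≤ B₁)
    (hfacts₀ : ∀ x : MemberY θ.d₆ θ.ℓ₆ θ.hd' θ.hL' θ.b₀ θ.b₁ Mstar, MF ≤ (geo9Y x).M → Facts347 (geo9Y x) (R x) (H x) dL δ₀ α L₀)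
    (hBεP : ∀ ε, 0 < ε → ε ≤ 1 → inputConst44 d δ₀ α NI N' (const37 d δ₀ α ρ B₀ Nc N' Cℓ K) L₀ (BI ε) (θI ε) ≤ Bε ε)
    (hBεβP : ∀ ε β, 0 < ε → ε ≤ 1 → 0 ≤ β → β < 1 → inputConst45 d δ₀ α NI N' L₀ (holderConst d δ₀ α NH N' (const37 d δ₀ α ρ B₀ Nc N' Cℓ K) (Bl β) (BV β)) (BI2 ε β) (θI (β + ε)) ≤ Bεβ ε β)
    (hB4P : twoConst d δ₀ α N2 B2 N' θ2 (const37 d δ₀ α ρ B₀ Nc N' Cℓ K) L₀ ≤ B₁)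
    (hE37 : ∀ x : MemberY θ.d₆ θ.ℓ₆ θ.hd' θ.hL' θ.b₀ θ.b₁ Mstar, ((opsYOfLetters N θ.toStage3Params Mstar 𝔏 𝔈) x).E37 = E37AllOfOps (W38OfOps (𝔬 x) (rd x) (R x) (H x) (const37 d δ₀ α ρ B₀ Nc N' Cℓ K) ((1 - 2 * α) * δ₀)) (𝔬 x) (R x) (H x) (const37 d δ₀ α ρ B₀ Nc N' Cℓ K) ((1 - 2 * α) * δ₀) ((opsYOfLetters N θ.toStage3Params Mstar 𝔏 𝔈) x).Gp B₁ δ₁ Bβ Bε Bεβ)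
    {E7 F7 W7 : MemberY θ.d₆ θ.ℓ₆ θ.hd' θ.hL' θ.b₀ θ.b₁ Mstar → Type} [∀ x, NormedAddCommGroup (E7 x)] [∀ x, InnerProductSpace ℝ (E7 x)] [∀ x, NormedAddCommGroup (F7 x)]
    [∀ x, InnerProductSpace ℝ (F7 x)] [∀ x, NormedAddCommGroup (W7 x)] [∀ x, InnerProductSpace ℝ (W7 x)] [∀ x, FiniteDimensional ℝ (W7 x)]
    (𝔬311 : ∀ x : MemberY θ.d₆ θ.ℓ₆ θ.hd' θ.hL' θ.b₀ θ.b₁ Mstar, Ops311 (bg9Y (Matrix (Fin N) (Fin N) ℂ) (specialUnitaryUnits (Fin N)) x) (E7 x) (F7 x) (W7 x)) (θ311 a311 M311 : ℝ) (ha311 : 0 < a311) (hM311 : 0 < M311)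
    (h311 : ∀ x : MemberY θ.d₆ θ.ℓ₆ θ.hd' θ.hL' θ.b₀ θ.b₁ Mstar, M311 ≤ (geo9Y x).M → ∀ α₀ : ℝ, 0 < α₀ → (geo9Y x).M * α₀ ≤ a311 →
      ∀ U : (bg9Y (Matrix (Fin N) (Fin N) ℂ) (specialUnitaryUnits (Fin N)) x).Cfg, (bg9Y (Matrix (Fin N) (Fin N) ℂ) (specialUnitaryUnits (Fin N)) x).Reg335 c35Y α₀ U → Inputs311 (𝔬311 x) θ311 (geo9Y x).M U)
    (hPD : ∀ x : MemberY θ.d₆ θ.ℓ₆ θ.hd' θ.hL' θ.b₀ θ.b₁ Mstar, ((opsYOfLetters N θ.toStage3Params Mstar 𝔏 𝔈) x).PosDef = PosDefOfOps (𝔬311 x))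
    {X3 Y3 ι3 A3 PX3 PY3 : MemberY θ.d₆ θ.ℓ₆ θ.hd' θ.hL' θ.b₀ θ.b₁ Mstar → Type} [∀ x, Fintype (X3 x)] [∀ x, DecidableEq (X3 x)] [∀ x, Fintype (Y3 x)] [∀ x, DecidableEq (Y3 x)]
    [∀ x, Fintype (ι3 x)] [∀ x, Fintype (A3 x)] [∀ x, Fintype (PX3 x)] [∀ x, DecidableEq (PX3 x)] [∀ x, Fintype (PY3 x)] [∀ x, DecidableEq (PY3 x)]
    (𝔬310 : ∀ x : MemberY θ.d₆ θ.ℓ₆ θ.hd' θ.hL' θ.b₀ θ.b₁ Mstar, Ops310 (geo9Y x) (bg9Y (Matrix (Fin N) (Fin N) ℂ) (specialUnitaryUnits (Fin N)) x) (X3 x) (Y3 x) (ι3 x) (A3 x))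
    (rd310 : ∀ x : MemberY θ.d₆ θ.ℓ₆ θ.hd' θ.hL' θ.b₀ θ.b₁ Mstar, WalkReading310 (geo9Y x) (bg9Y (Matrix (Fin N) (Fin N) ℂ) (specialUnitaryUnits (Fin N)) x) (X3 x) (ι3 x) (A3 x))
    (𝔭3 : ∀ x : MemberY θ.d₆ θ.ℓ₆ θ.hd' θ.hL' θ.b₀ θ.b₁ Mstar, HolderProbes (geo9Y x) (bg9Y (Matrix (Fin N) (Fin N) ℂ) (specialUnitaryUnits (Fin N)) x) (X3 x) (Y3 x) (PX3 x) (PY3 x)) (SH3 SL3 SI3 S23 : ∀ x : MemberY θ.d₆ θ.ℓ₆ θ.hd' θ.hL' θ.b₀ θ.b₁ Mstar, ι3 x → Finset (geo9Y x).Site) (Bl3 θH3 BI3 θI3 : ℝ → ℝ)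
    (BI23 : ℝ → ℝ → ℝ) (NH3 NL3 BL3 MF3 NI3 N23 B23 θ23 : ℝ) (dL3 : ℕ)
    (R310 : MemberY θ.d₆ θ.ℓ₆ θ.hd' θ.hL' θ.b₀ θ.b₁ Mstar → ℝ) (H310 : MemberY θ.d₆ θ.ℓ₆ θ.hd' θ.hL' θ.b₀ θ.b₁ Mstar → Prop) (κ310 : MemberY θ.d₆ θ.ℓ₆ θ.hd' θ.hL' θ.b₀ θ.b₁ Mstar → Sizes310)
    (bH3 : ∀ x : MemberY θ.d₆ θ.ℓ₆ θ.hd' θ.hL' θ.b₀ θ.b₁ Mstar, ℝ → BlockNorm (toB6 (geo9Y x) (R310 x) (H310 x)) (Y3 x → ℝ))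
    (d3 : ℕ) (α3 ρ3 N3 N3' NF3 Cℓ3 K3 θ3 B3 δ3 a3 M3 ML3 : ℝ)
    (hα3 : 0 ≤ α3) (hα3' : α3 ≤ 1 / 2) (hN3 : 0 ≤ N3) (hN3' : 0 ≤ N3') (hNF3 : 0 ≤ NF3) (hCℓ3 : 1 ≤ Cℓ3) (hK3 : 0 ≤ K3) (hθ3 : 0 ≤ θ3) (hB3 : 0 < B3)
    (hδ3 : 0 < δ3) (ha3 : 0 < a3) (hM3 : 0 < M3) (hNH3 : 0 ≤ NH3) (hNL3 : 0 ≤ NL3) (hBL3 : 0 ≤ BL3) (hNI3 : 0 ≤ NI3) (hN23 : 0 ≤ N23) (hB23 : 0 ≤ B23) (hθ23 : 0 ≤ θ23) (hst3 : ∀ x, StaticOK310 (𝔬310 x) ρ3 N3 N3' NF3 Cℓ3 (κ310 x)) (hκ3 : ∀ x, (κ310 x).Bounded K3)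
    (hrd3 : ∀ x, (rd310 x).OK (𝔬310 x).blk) (hloc3 : ∀ x, Locality310 (𝔬310 x) (rd310 x))
    (h261_3 : ∀ x : MemberY θ.d₆ θ.ℓ₆ θ.hd' θ.hL' θ.b₀ θ.b₁ Mstar, ML3 ≤ (geo9Y x).M → Ineq261 d3 (toB6 (geo9Y x) (R310 x) (H310 x)) δ3 α3)
    (h36_3 : ∀ x : MemberY θ.d₆ θ.ℓ₆ θ.hd' θ.hL' θ.b₀ θ.b₁ Mstar, M3 ≤ (geo9Y x).M → ∀ α₀ : ℝ, 0 < α₀ → c35Y * (geo9Y x).M * α₀ ≤ a3 →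
      ∀ U : (bg9Y (Matrix (Fin N) (Fin N) ℂ) (specialUnitaryUnits (Fin N)) x).Cfg, (bg9Y (Matrix (Fin N) (Fin N) ℂ) (specialUnitaryUnits (Fin N)) x).Reg335 c35Y α₀ U →
        Local342G (𝔬310 x) (R310 x) (H310 x) B3 δ3 U ∧ B9Thm310Whole.Factors389 (𝔬310 x) (R310 x) (H310 x) θ3 δ3 U ∧ Identities310 (𝔬310 x) (R310 x) (H310 x) U)
    (h36H3 : ∀ x, M3 ≤ (geo9Y x).M → ∀ α₀ : ℝ, 0 < α₀ → c35Y * (geo9Y x).M * α₀ ≤ a3 → ∀ U : (bg9Y (Matrix (Fin N) (Fin N) ℂ) (specialUnitaryUnits (Fin N)) x).Cfg, (bg9Y (Matrix (Fin N) (Fin N) ℂ) (specialUnitaryUnits (Fin N)) x).Reg335 c35Y α₀ U →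
      HolderLegs310 (𝔬310 x) (𝔭3 x) (R310 x) (H310 x) (SH3 x) Bl3 δ3 U ∧ FactorsHolder310 (𝔬310 x) (𝔭3 x) (R310 x) (H310 x) θH3 δ3 U ∧ LapLegs310 (𝔬310 x) (R310 x) (H310 x) (SL3 x) BL3 δ3 U ∧
        InputLegs310 (𝔬310 x) (𝔭3 x) (R310 x) (H310 x) (bH3 x) (SI3 x) BI3 BI23 δ3 U ∧ FactorsInput310 (𝔬310 x) (R310 x) (H310 x) (bH3 x) θI3 δ3 U ∧
        L2TwoLegs310 (𝔬310 x) (R310 x) (H310 x) (S23 x) B23 δ3 U ∧ FactorsL2_310 (𝔬310 x) (R310 x) (H310 x) θ23 δ3 U)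
    (hcntH3 : ∀ (x : MemberY θ.d₆ θ.ℓ₆ θ.hd' θ.hL' θ.b₀ θ.b₁ Mstar) (a : (geo9Y x).Site), (∑ q, if a ∈ SH3 x q then (1 : ℝ) else 0) ≤ NH3) (hcntL3 : ∀ (x : MemberY θ.d₆ θ.ℓ₆ θ.hd' θ.hL' θ.b₀ θ.b₁ Mstar) (a : (geo9Y x).Site), (∑ q, if a ∈ SL3 x q then (1 : ℝ) else 0) ≤ NL3)
    (hcntI3 : ∀ (x : MemberY θ.d₆ θ.ℓ₆ θ.hd' θ.hL' θ.b₀ θ.b₁ Mstar) (a : (geo9Y x).Site), (∑ q, if a ∈ SI3 x q then (1 : ℝ) else 0) ≤ NI3) (hcnt23 : ∀ (x : MemberY θ.d₆ θ.ℓ₆ θ.hd' θ.hL' θ.b₀ θ.b₁ Mstar) (a : (geo9Y x).Site), (∑ q, if a ∈ S23 x q then (1 : ℝ) else 0) ≤ N23)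
    (hBl3 : ∀ β, 0 ≤ β → β < 1 → 0 ≤ Bl3 β) (hθH3 : ∀ β, 0 ≤ β → β < 1 → 0 ≤ θH3 β)
    (hBI3 : ∀ ε, 0 < ε → ε ≤ 1 → 0 ≤ BI3 ε) (hBI23 : ∀ ε β, 0 < ε → ε ≤ 1 → 0 ≤ β → β < 1 → 0 ≤ BI23 ε β) (hθI3 : ∀ ε, 0 < ε → 0 ≤ θI3 ε)
    (ev3 : ∀ x : MemberY θ.d₆ θ.ℓ₆ θ.hd' θ.hL' θ.b₀ θ.b₁ Mstar, (geo9Y x).Loc → X3 x → ℝ) (evY3 : ∀ x : MemberY θ.d₆ θ.ℓ₆ θ.hd' θ.hL' θ.b₀ θ.b₁ Mstar, (geo9Y x).Loc → Y3 x → ℝ)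
    (hcoA0 : ∀ x U, CoRealizes ((opsYOfLetters N θ.toStage3Params Mstar 𝔏 𝔈) x).GA 0 U (𝔬310 x).blk (𝔬310 x).blk (ev3 x) ((𝔬310 x).G U)) (hcoA1 : ∀ x U, CoRealizes ((opsYOfLetters N θ.toStage3Params Mstar 𝔏 𝔈) x).GA 1 U (𝔬310 x).blkY (𝔬310 x).blk (ev3 x) ((𝔬310 x).D U ∘ₗ (𝔬310 x).G U))
    (hcoA2 : ∀ x U, CoRealizes ((opsYOfLetters N θ.toStage3Params Mstar 𝔏 𝔈) x).GA 2 U (𝔬310 x).blk (𝔬310 x).blkY (evY3 x) ((𝔬310 x).G U ∘ₗ (𝔬310 x).Dstar U)) (hcoA3 : ∀ x U, CoRealizes ((opsYOfLetters N θ.toStage3Params Mstar 𝔏 𝔈) x).GA 3 U (𝔬310 x).blk (𝔬310 x).blk (ev3 x) ((𝔬310 x).Lap U ∘ₗ (𝔬310 x).G U))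
    (hglA0 : ∀ x U, GlobReads ((opsYOfLetters N θ.toStage3Params Mstar 𝔏 𝔈) x).GA 0 U (𝔬310 x).blk (𝔬310 x).blk (ev3 x) ((𝔬310 x).G U)) (hglA1 : ∀ x U, GlobReads ((opsYOfLetters N θ.toStage3Params Mstar 𝔏 𝔈) x).GA 1 U (𝔬310 x).blkY (𝔬310 x).blk (ev3 x) ((𝔬310 x).D U ∘ₗ (𝔬310 x).G U))
    (hglA2 : ∀ x U, GlobReads ((opsYOfLetters N θ.toStage3Params Mstar 𝔏 𝔈) x).GA 2 U (𝔬310 x).blk (𝔬310 x).blkY (evY3 x) ((𝔬310 x).G U ∘ₗ (𝔬310 x).Dstar U)) (hglA3 : ∀ x U, GlobReads ((opsYOfLetters N θ.toStage3Params Mstar 𝔏 𝔈) x).GA 3 U (𝔬310 x).blk (𝔬310 x).blk (ev3 x) ((𝔬310 x).Lap U ∘ₗ (𝔬310 x).G U))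
    (hlA0 : ∀ x U, L2Reads (R := R310 x) (H := H310 x) ((opsYOfLetters N θ.toStage3Params Mstar 𝔏 𝔈) x).GA 0 U (𝔬310 x).blk (𝔬310 x).blk (ev3 x) ((𝔬310 x).G U)) (hlA1 : ∀ x U, L2Reads (R := R310 x) (H := H310 x) ((opsYOfLetters N θ.toStage3Params Mstar 𝔏 𝔈) x).GA 1 U (𝔬310 x).blkY (𝔬310 x).blk (ev3 x) ((𝔬310 x).D U ∘ₗ (𝔬310 x).G U))
    (hlA2 : ∀ x U, L2Reads (R := R310 x) (H := H310 x) ((opsYOfLetters N θ.toStage3Params Mstar 𝔏 𝔈) x).GA 2 U (𝔬310 x).blk (𝔬310 x).blkY (evY3 x) ((𝔬310 x).G U ∘ₗ (𝔬310 x).Dstar U)) (hlA3 : ∀ x U, L2Reads (R := R310 x) (H := H310 x) ((opsYOfLetters N θ.toStage3Params Mstar 𝔏 𝔈) x).GA 3 U (𝔬310 x).blk (𝔬310 x).blk (ev3 x) ((𝔬310 x).Lap U ∘ₗ (𝔬310 x).G U))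
    (hlA4 : ∀ x U, L2Reads (R := R310 x) (H := H310 x) ((opsYOfLetters N θ.toStage3Params Mstar 𝔏 𝔈) x).GA 4 U (𝔬310 x).blkY (𝔬310 x).blkY (evY3 x) ((𝔬310 x).D U ∘ₗ ((𝔬310 x).G U ∘ₗ (𝔬310 x).Dstar U)))
    (hlA5 : ∀ x U, L2Reads (R := R310 x) (H := H310 x) ((opsYOfLetters N θ.toStage3Params Mstar 𝔏 𝔈) x).GA 5 U (𝔬310 x).blk (𝔬310 x).blk (ev3 x) ((𝔬310 x).G U ∘ₗ (𝔬310 x).Lap U))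
    (hH13 : ∀ x U, H1Reads ((opsYOfLetters N θ.toStage3Params Mstar 𝔏 𝔈) x).GA U (𝔭3 x) (𝔬310 x).blk (𝔬310 x).blkY (ev3 x) (evY3 x) ((𝔬310 x).D U ∘ₗ (𝔬310 x).G U) ((𝔬310 x).G U ∘ₗ (𝔬310 x).Dstar U))
    (hIR3 : ∀ x U, InputReads ((opsYOfLetters N θ.toStage3Params Mstar 𝔏 𝔈) x).GA U (𝔭3 x) (bH3 x) (𝔬310 x).blkY (evY3 x) ((𝔬310 x).D U ∘ₗ ((𝔬310 x).G U ∘ₗ (𝔬310 x).Dstar U)))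
    (hsymA : ∀ x U, IsTransposePair ((𝔬310 x).G U) ((𝔬310 x).G U)) (htrA : ∀ x U, IsTransposePair ((𝔬310 x).D U ∘ₗ (𝔬310 x).G U) ((𝔬310 x).G U ∘ₗ (𝔬310 x).Dstar U)) (hadjLA : ∀ x U, IsTransposePair ((𝔬310 x).Lap U ∘ₗ (𝔬310 x).G U) ((𝔬310 x).G U ∘ₗ (𝔬310 x).Lap U))
    {dFA : ℕ} {αFA L₀A MgA : ℝ}
    (hfactsA : ∀ x : MemberY θ.d₆ θ.ℓ₆ θ.hd' θ.hL' θ.b₀ θ.b₁ Mstar, MgA ≤ (geo9Y x).M → Facts347 (geo9Y x) (R310 x) (H310 x) dFA ((1 - 2 * α3) * δ3) αFA L₀A)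
    (hCB3 : (const37 d3 δ3 α3 ρ3 B3 N3 N3' Cℓ3 K3) ≤ B₁) (hCL3 : (const37 d3 δ3 α3 ρ3 B3 N3 N3' Cℓ3 K3) * L₀A ≤ B₁) (hδ₁le3 : δ₁ ≤ (1 - 2 * αFA) * ((1 - 2 * α3) * δ3)) (hαFA : 0 ≤ αFA * ((1 - 2 * α3) * δ3)) (hαFA2 : αFA ≤ 1 / 2)
    (hCg3 : (const37 d3 δ3 α3 ρ3 B3 N3 N3' Cℓ3 K3) * B6.c1 dFA ((1 - 2 * α3) * δ3) (1 - αFA) * L₀A ^ (4 : ℝ) ≤ B₁)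
    (hBβ3 : ∀ β, 0 ≤ β → β < 1 → holderConst d3 δ3 α3 NH3 NF3 (const37 d3 δ3 α3 ρ3 B3 N3 N3' Cℓ3 K3) (Bl3 β) (θH3 β) ≤ Bβ β) (hB53 : Real.sqrt ((const37 d3 δ3 α3 ρ3 B3 N3 N3' Cℓ3 K3) * lapConst d3 δ3 α3 NL3 BL3 L₀A) * L₀A ≤ B₁)
    (hfactsA₀ : ∀ x : MemberY θ.d₆ θ.ℓ₆ θ.hd' θ.hL' θ.b₀ θ.b₁ Mstar, MF3 ≤ (geo9Y x).M → Facts347 (geo9Y x) (R310 x) (H310 x) dL3 δ3 α3 L₀A)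
    (hBε3 : ∀ ε, 0 < ε → ε ≤ 1 → inputConst44 d3 δ3 α3 NI3 NF3 (const37 d3 δ3 α3 ρ3 B3 N3 N3' Cℓ3 K3) L₀A (BI3 ε) (θI3 ε) ≤ Bε ε)
    (hBεβ3 : ∀ ε β, 0 < ε → ε ≤ 1 → 0 ≤ β → β < 1 →
      inputConst45 d3 δ3 α3 NI3 NF3 L₀A (holderConst d3 δ3 α3 NH3 NF3 (const37 d3 δ3 α3 ρ3 B3 N3 N3' Cℓ3 K3) (Bl3 β) (θH3 β)) (BI23 ε β) (θI3 (β + ε)) ≤ Bεβ ε β)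
    (hB43 : twoConst d3 δ3 α3 N23 B23 NF3 θ23 (const37 d3 δ3 α3 ρ3 B3 N3 N3' Cℓ3 K3) L₀A ≤ B₁)
    (hE310 : ∀ x : MemberY θ.d₆ θ.ℓ₆ θ.hd' θ.hL' θ.b₀ θ.b₁ Mstar, ((opsYOfLetters N θ.toStage3Params Mstar 𝔏 𝔈) x).E310 = W310OfOps (𝔬310 x) (rd310 x) (ConvAll3107 (𝔬310 x) (R310 x) (H310 x) (const37 d3 δ3 α3 ρ3 B3 N3 N3' Cℓ3 K3) ((1 - 2 * α3) * δ3) ((opsYOfLetters N θ.toStage3Params Mstar 𝔏 𝔈) x).GA B₁ δ₁ Bβ Bε Bεβ))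
    {E₁ E₂ : ∀ x : MemberY θ.d₆ θ.ℓ₆ θ.hd' θ.hL' θ.b₀ θ.b₁ Mstar, B9.RWExpansion (geo9Y x) (bg9Y (Matrix (Fin N) (Fin N) ℂ) (specialUnitaryUnits (Fin N)) x)}
    {termK₁ : ∀ x : MemberY θ.d₆ θ.ℓ₆ θ.hd' θ.hL' θ.b₀ θ.b₁ Mstar, (E₁ x).Walk → B9.KernelFamily (geo9Y x) (bg9Y (Matrix (Fin N) (Fin N) ℂ) (specialUnitaryUnits (Fin N)) x)}
    {termK₂ : ∀ x : MemberY θ.d₆ θ.ℓ₆ θ.hd' θ.hL' θ.b₀ θ.b₁ Mstar, (E₂ x).Walk → B9.KernelFamily (geo9Y x) (bg9Y (Matrix (Fin N) (Fin N) ℂ) (specialUnitaryUnits (Fin N)) x)}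
    (X₁ : ∀ x : MemberY θ.d₆ θ.ℓ₆ θ.hd' θ.hL' θ.b₀ θ.b₁ Mstar, (E₁ x).Walk → ℕ → (geo9Y x).Site → Prop) (Meets₁ : ∀ x : MemberY θ.d₆ θ.ℓ₆ θ.hd' θ.hL' θ.b₀ θ.b₁ Mstar, (E₁ x).Walk → ℕ → Prop)
    (X₂ : ∀ x : MemberY θ.d₆ θ.ℓ₆ θ.hd' θ.hL' θ.b₀ θ.b₁ Mstar, (E₂ x).Walk → ℕ → (geo9Y x).Site → Prop) (Meets₂ : ∀ x : MemberY θ.d₆ θ.ℓ₆ θ.hd' θ.hL' θ.b₀ θ.b₁ Mstar, (E₂ x).Walk → ℕ → Prop)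
    (diam : MemberY θ.d₆ θ.ℓ₆ θ.hd' θ.hL' θ.b₀ θ.b₁ Mstar → ℝ) (r₀ : ℝ) (hr : ∀ x, diam x ≤ r₀)
    (near₁ : ∀ (x : MemberY θ.d₆ θ.ℓ₆ θ.hd' θ.hL' θ.b₀ θ.b₁ Mstar) ω m p, Meets₁ x ω m → X₁ x ω m p → ∃ q, q ∈ OmegaC x.D x.D' ∧ tdistK (ℓ := θ.ℓ₆) (Mh := x.Mh) (k := x.k) (P := x.P') (kLab x p) q ≤ diam x)
    (first_mem₁ : ∀ (x : MemberY θ.d₆ θ.ℓ₆ θ.hd' θ.hL' θ.b₀ θ.b₁ Mstar) ω y, (E₁ x).first ω y → X₁ x ω 0 y)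
    (chain₁ : ∀ (x : MemberY θ.d₆ θ.ℓ₆ θ.hd' θ.hL' θ.b₀ θ.b₁ Mstar) ω y y', (E₁ x).first ω y → (E₁ x).last ω y' → ∃ l : List (geo9Y x).Site, l.length = (E₁ x).wlen ω ∧
      (∀ (m : ℕ) (hm : m < l.length), X₁ x ω (m + 1) (l[m])) ∧ B9Thm314.chainSum (geo9Y x).dist y l y' ≤ (E₁ x).wdist ω y y')
    (near₂ : ∀ (x : MemberY θ.d₆ θ.ℓ₆ θ.hd' θ.hL' θ.b₀ θ.b₁ Mstar) ω m p, Meets₂ x ω m → X₂ x ω m p → ∃ q, q ∈ OmegaC x.D x.D' ∧ tdistK (ℓ := θ.ℓ₆) (Mh := x.Mh) (k := x.k) (P := x.P') (kLab x p) q ≤ diam x)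
    (first_mem₂ : ∀ (x : MemberY θ.d₆ θ.ℓ₆ θ.hd' θ.hL' θ.b₀ θ.b₁ Mstar) ω y, (E₂ x).first ω y → X₂ x ω 0 y)
    (chain₂ : ∀ (x : MemberY θ.d₆ θ.ℓ₆ θ.hd' θ.hL' θ.b₀ θ.b₁ Mstar) ω y y', (E₂ x).first ω y → (E₂ x).last ω y' → ∃ l : List (geo9Y x).Site, l.length = (E₂ x).wlen ω ∧
      (∀ (m : ℕ) (hm : m < l.length), X₂ x ω (m + 1) (l[m])) ∧ B9Thm314.chainSum (geo9Y x).dist y l y' ≤ (E₂ x).wdist ω y y')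
    (h₁ : Thm310AllNormsPrinted c35Y geo9Y (bg9Y (Matrix (Fin N) (Fin N) ℂ) (specialUnitaryUnits (Fin N))) E₁ termK₁) (h₂ : Thm310AllNormsPrinted c35Y geo9Y (bg9Y (Matrix (Fin N) (Fin N) ℂ) (specialUnitaryUnits (Fin N))) E₂ termK₂)
    (W₁ : ∀ x : MemberY θ.d₆ θ.ℓ₆ θ.hd' θ.hL' θ.b₀ θ.b₁ Mstar, ℕ → (geo9Y x).Site → (geo9Y x).Site → Finset (E₁ x).Walk) (W₂ : ∀ x : MemberY θ.d₆ θ.ℓ₆ θ.hd' θ.hL' θ.b₀ θ.b₁ Mstar, ℕ → (geo9Y x).Site → (geo9Y x).Site → Finset (E₂ x).Walk)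
    (hW₁ : ∀ x, WalkSetsSpec (E₁ x) (W₁ x)) (hW₂ : ∀ x, WalkSetsSpec (E₂ x) (W₂ x))
    (hcnt₁ : WalkWeightsSummable geo9Y (bg9Y (Matrix (Fin N) (Fin N) ℂ) (specialUnitaryUnits (Fin N))) E₁ W₁) (hcnt₂ : WalkWeightsSummable geo9Y (bg9Y (Matrix (Fin N) (Fin N) ℂ) (specialUnitaryUnits (Fin N))) E₂ W₂)
    (hdom : ∀ (x : MemberY θ.d₆ θ.ℓ₆ θ.hd' θ.hL' θ.b₀ θ.b₁ Mstar) (U : (bg9Y (Matrix (Fin N) (Fin N) ℂ) (specialUnitaryUnits (Fin N)) x).Cfg), (E₁ x).Converges U ∧ (E₂ x).Converges U →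
      DominatedBySums (pairExpansion (E₁ x) (E₂ x) (locDataY x (E₁ x) (X₁ x) (Meets₁ x) (diam x)).Touches (locData₂ (locDataY x (E₁ x) (X₁ x) (Meets₁ x) (diam x)) (X₂ x) (Meets₂ x)).Touches)
        (pairTermK (E₁ x) (E₂ x) _ _ (termK₁ x) (termK₂ x)) ((opsYOfLetters N θ.toStage3Params Mstar 𝔏 𝔈) x).Kdiff (pairWalkSets (W₁ x) (W₂ x) (locDataY x (E₁ x) (X₁ x) (Meets₁ x) (diam x)).Touches (locData₂ (locDataY x (E₁ x) (X₁ x) (Meets₁ x) (diam x)) (X₂ x) (Meets₂ x)).Touches) U)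
    {𝔸5 : Type} [NormedRing 𝔸5] {P5 W5 : MemberY θ.d₆ θ.ℓ₆ θ.hd' θ.hL' θ.b₀ θ.b₁ Mstar → Type} [∀ x, Fintype (P5 x)]
    (𝔬315 : ∀ x : MemberY θ.d₆ θ.ℓ₆ θ.hd' θ.hL' θ.b₀ θ.b₁ Mstar, Ops315 (geo9Y x) (bg9Y (Matrix (Fin N) (Fin N) ℂ) (specialUnitaryUnits (Fin N)) x) 𝔸5 (P5 x) (W5 x)) {K5 r5 m5 a5 δ5 B5 : ℝ}
    (hK5 : 0 < K5) (hm5 : 0 < m5) (ha5 : 0 < a5) (hδ5 : 0 < δ5) (hB5 : 0 < B5)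
    (hR5 : ∀ x : MemberY θ.d₆ θ.ℓ₆ θ.hd' θ.hL' θ.b₀ θ.b₁ Mstar, Reads315 (𝔬315 x) ((opsYOfLetters N θ.toStage3Params Mstar 𝔏 𝔈) x).Ck (inΛY x) K5) (hS5 : ∀ x : MemberY θ.d₆ θ.ℓ₆ θ.hd' θ.hL' θ.b₀ θ.b₁ Mstar, Static315 (𝔬315 x) (unitDistY x) r5 m5)
    (h315 : ∀ (x : MemberY θ.d₆ θ.ℓ₆ θ.hd' θ.hL' θ.b₀ θ.b₁ Mstar) (α₀ : ℝ), 0 < α₀ → (geo9Y x).M * α₀ ≤ a5 →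
      ∀ U : (bg9Y (Matrix (Fin N) (Fin N) ℂ) (specialUnitaryUnits (Fin N)) x).Cfg, (bg9Y (Matrix (Fin N) (Fin N) ℂ) (specialUnitaryUnits (Fin N)) x).Reg335 c35Y α₀ U → (bg9Y (Matrix (Fin N) (Fin N) ℂ) (specialUnitaryUnits (Fin N)) x).Reg336 c35Y α₀ U →
        GivenBy3185OfOps (𝔬315 x) U ∧ HasRWExpCOfOps (𝔬315 x) (unitDistY x) B5 U δ5)
    (hG315 : ∀ (x : MemberY θ.d₆ θ.ℓ₆ θ.hd' θ.hL' θ.b₀ θ.b₁ Mstar) (U : (bg9Y (Matrix (Fin N) (Fin N) ℂ) (specialUnitaryUnits (Fin N)) x).Cfg), GivenBy3185OfOps (𝔬315 x) U → ((opsYOfLetters N θ.toStage3Params Mstar 𝔏 𝔈) x).GivenBy3185 U)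
    (hH315 : ∀ (x : MemberY θ.d₆ θ.ℓ₆ θ.hd' θ.hL' θ.b₀ θ.b₁ Mstar) (U : (bg9Y (Matrix (Fin N) (Fin N) ℂ) (specialUnitaryUnits (Fin N)) x).Cfg) (δ' : ℝ), HasRWExpCOfOps (𝔬315 x) (unitDistY x) B5 U δ' → ((opsYOfLetters N θ.toStage3Params Mstar 𝔏 𝔈) x).HasRWExpC U δ')
    {X12 Y12 Z12 W12 : MemberY θ.d₆ θ.ℓ₆ θ.hd' θ.hL' θ.b₀ θ.b₁ Mstar → Type} [∀ x, Fintype (X12 x)] [∀ x, DecidableEq (X12 x)] [∀ x, Fintype (Y12 x)] [∀ x, Fintype (Z12 x)]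
    [∀ x, Fintype (W12 x)]
    (𝔬12 : ∀ x : MemberY θ.d₆ θ.ℓ₆ θ.hd' θ.hL' θ.b₀ θ.b₁ Mstar, B9Thm312Whole.Ops (geo9Y x) (bg9Y (Matrix (Fin N) (Fin N) ℂ) (specialUnitaryUnits (Fin N)) x) (X12 x) (Y12 x) (Z12 x) (W12 x)) (R12 : MemberY θ.d₆ θ.ℓ₆ θ.hd' θ.hL' θ.b₀ θ.b₁ Mstar → ℝ) (H12 : MemberY θ.d₆ θ.ℓ₆ θ.hd' θ.hL' θ.b₀ θ.b₁ Mstar → Prop)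
    (ev12 : ∀ x : MemberY θ.d₆ θ.ℓ₆ θ.hd' θ.hL' θ.b₀ θ.b₁ Mstar, (geo9Y x).Loc → X12 x → ℝ) (evY12 : ∀ x : MemberY θ.d₆ θ.ℓ₆ θ.hd' θ.hL' θ.b₀ θ.b₁ Mstar, (geo9Y x).Loc → Y12 x → ℝ)
    (θ12 r12 B12₀ δ12₀ δK12 σ12 ρ12 a12 M12 B12₁ δ12₁ : ℝ) (Bβ12 Bε12 : ℝ → ℝ) (Bεβ12 : ℝ → ℝ → ℝ)
    (hθ12 : 0 ≤ θ12) (hr12 : 0 ≤ r12) (hB12₀ : 0 ≤ B12₀) (hρ12 : 0 < ρ12) (hρS12 : ρ12 ≤ δ12₀) (hρδ12 : ρ12 + σ12 ≤ δK12) (hσ12 : 0 < σ12)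
    (ha12 : 0 < a12) (hM12 : 0 < M12) (hB12₁ : 0 ≤ B12₁) (hδ12₁ : 0 < δ12₁) (hBβ12 : ∀ β, 0 ≤ Bβ12 β) (hBε12 : ∀ ε, 0 ≤ Bε12 ε) (hBεβ12 : ∀ ε β, 0 ≤ Bεβ12 ε β)
    (hco12 : ∀ (x : MemberY θ.d₆ θ.ℓ₆ θ.hd' θ.hL' θ.b₀ θ.b₁ Mstar) (U : (bg9Y (Matrix (Fin N) (Fin N) ℂ) (specialUnitaryUnits (Fin N)) x).Cfg),
      CoRealizes ((opsYOfLetters N θ.toStage3Params Mstar 𝔏 𝔈) x).GD 0 U (𝔬12 x).blk (𝔬12 x).blk (ev12 x) ((𝔬12 x).G U) ∧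
      CoRealizes ((opsYOfLetters N θ.toStage3Params Mstar 𝔏 𝔈) x).GD 2 U (𝔬12 x).blk (𝔬12 x).blkY (evY12 x) ((𝔬12 x).G U ∘ₗ (𝔬12 x).Dstar U) ∧
      CoRealizes ((opsYOfLetters N θ.toStage3Params Mstar 𝔏 𝔈) x).G₁ 0 U (𝔬12 x).blk (𝔬12 x).blk (ev12 x) ((𝔬12 x).G1 U) ∧
      CoRealizes ((opsYOfLetters N θ.toStage3Params Mstar 𝔏 𝔈) x).G₁ 2 U (𝔬12 x).blk (𝔬12 x).blkY (evY12 x) ((𝔬12 x).G1 U ∘ₗ (𝔬12 x).Dstar U))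
    (hmodel12 : ∀ x : MemberY θ.d₆ θ.ℓ₆ θ.hd' θ.hL' θ.b₀ θ.b₁ Mstar, M12 ≤ (geo9Y x).M → ∀ α₀ : ℝ, 0 < α₀ → (geo9Y x).M * α₀ ≤ a12 →
      ∀ U : (bg9Y (Matrix (Fin N) (Fin N) ℂ) (specialUnitaryUnits (Fin N)) x).Cfg, (bg9Y (Matrix (Fin N) (Fin N) ℂ) (specialUnitaryUnits (Fin N)) x).Reg335 c35Y α₀ U → (bg9Y (Matrix (Fin N) (Fin N) ℂ) (specialUnitaryUnits (Fin N)) x).Reg336 c35Y α₀ U →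
        Thm33G0 (𝔬12 x) (R12 x) (H12 x) B12₀ δ12₀ U ∧
        B9Thm312Whole.Step (𝔬12 x) (R12 x) (H12 x) (fun y => (geo9Y_len_pos x y).le) 1 (θ12 * ((geo9Y x).M * α₀)) δK12 U ∧
        B9Thm312Whole.Step (𝔬12 x) (R12 x) (H12 x) (fun y => (geo9Y_len_pos x y).le) 2 (θ12 * ((geo9Y x).M * α₀)) δK12 U ∧
        FormSmall (𝔬12 x) (r12 * ((geo9Y x).M * α₀)) U ∧ B9Thm312Whole.Identities (𝔬12 x) U)
    (hres12 : ∀ x : MemberY θ.d₆ θ.ℓ₆ θ.hd' θ.hL' θ.b₀ θ.b₁ Mstar, M12 ≤ (geo9Y x).M → ∀ α₀ : ℝ, 0 < α₀ → (geo9Y x).M * α₀ ≤ a12 →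
      ∀ U : (bg9Y (Matrix (Fin N) (Fin N) ℂ) (specialUnitaryUnits (Fin N)) x).Cfg, (bg9Y (Matrix (Fin N) (Fin N) ℂ) (specialUnitaryUnits (Fin N)) x).Reg335 c35Y α₀ U → (bg9Y (Matrix (Fin N) (Fin N) ℂ) (specialUnitaryUnits (Fin N)) x).Reg336 c35Y α₀ U →
        (∀ K ∈ [((opsYOfLetters N θ.toStage3Params Mstar 𝔏 𝔈) x).GD, ((opsYOfLetters N θ.toStage3Params Mstar 𝔏 𝔈) x).G₁], Clause342 K 1 B12₁ δ12₁ U ∧ L2Block K B12₁ δ12₁ U ∧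
          (∀ (n : Fin 4) (lam : (geo9Y x).Loc) (γ : ℝ), n ≠ 3 → -4 ≤ γ → γ ≤ 4 →
            K.glob n U lam γ ≤ B12₁ * (geo9Y x).wNorm γ lam) ∧
          B9.Ineq343_345 K Bβ12 Bε12 Bεβ12 δ12₁ U) ∧
        (∀ Hk' ∈ [((opsYOfLetters N θ.toStage3Params Mstar 𝔏 𝔈) x).H, ((opsYOfLetters N θ.toStage3Params Mstar 𝔏 𝔈) x).H₁], B9.Ineq3133 (θ.d₆ + 1) Hk' B12₁ Bβ12 δ12₁ U))
    (hpinE : ∀ x : MemberY θ.d₆ θ.ℓ₆ θ.hd' θ.hL' θ.b₀ θ.b₁ Mstar, ((opsYOfLetters N θ.toStage3Params Mstar 𝔏 𝔈) x).HasRWExp = HasRWExpOfOps (𝔬12 x))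
    (hpinH : ∀ x : MemberY θ.d₆ θ.ℓ₆ θ.hd' θ.hL' θ.b₀ θ.b₁ Mstar, ((opsYOfLetters N θ.toStage3Params Mstar 𝔏 𝔈) x).HasRWExpH = HasRWExpHOfOps (𝔬12 x))
    (hpinK : ∀ x : MemberY θ.d₆ θ.ℓ₆ θ.hd' θ.hL' θ.b₀ θ.b₁ Mstar, ((opsYOfLetters N θ.toStage3Params Mstar 𝔏 𝔈) x).PosDefK = PosDefKOfOps (𝔬12 x))
    (B13 δ13 ρ13 : ℝ) (hB13 : 0 ≤ B13) (hρ13 : 0 < ρ13) (hρ13ρ : ρ13 + 3 * σ12 ≤ ρ12) (hρδ13 : ρ12 ≤ δ13)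
    (hco13 : ∀ (x : MemberY θ.d₆ θ.ℓ₆ θ.hd' θ.hL' θ.b₀ θ.b₁ Mstar) (U : (bg9Y (Matrix (Fin N) (Fin N) ℂ) (specialUnitaryUnits (Fin N)) x).Cfg),
      CoRealizes ((opsYOfLetters N θ.toStage3Params Mstar 𝔏 𝔈) x).GG 0 U (𝔬12 x).blk (𝔬12 x).blk (ev12 x) ((𝔬12 x).GG U) ∧
      CoRealizes ((opsYOfLetters N θ.toStage3Params Mstar 𝔏 𝔈) x).GG 2 U (𝔬12 x).blk (𝔬12 x).blkY (evY12 x) ((𝔬12 x).GG U ∘ₗ (𝔬12 x).Dstar U))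
    (hletters13 : ∀ x : MemberY θ.d₆ θ.ℓ₆ θ.hd' θ.hL' θ.b₀ θ.b₁ Mstar, M12 ≤ (geo9Y x).M → ∀ α₀ : ℝ, 0 < α₀ → (geo9Y x).M * α₀ ≤ a12 →
      ∀ U : (bg9Y (Matrix (Fin N) (Fin N) ℂ) (specialUnitaryUnits (Fin N)) x).Cfg, (bg9Y (Matrix (Fin N) (Fin N) ℂ) (specialUnitaryUnits (Fin N)) x).Reg335 c35Y α₀ U → (bg9Y (Matrix (Fin N) (Fin N) ℂ) (specialUnitaryUnits (Fin N)) x).Reg336 c35Y α₀ U →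
        Letters313 (𝔬12 x) (R12 x) (H12 x) ⟨geo9Y_dist_triangle x, geo9Y_dist_comm x, geo9K_dist_nonneg x.toKIdx, geo9Y_len_pos x⟩ B13 δ13 U)
    (hres13 : ∀ x : MemberY θ.d₆ θ.ℓ₆ θ.hd' θ.hL' θ.b₀ θ.b₁ Mstar, M12 ≤ (geo9Y x).M → ∀ α₀ : ℝ, 0 < α₀ → (geo9Y x).M * α₀ ≤ a12 →
      ∀ U : (bg9Y (Matrix (Fin N) (Fin N) ℂ) (specialUnitaryUnits (Fin N)) x).Cfg, (bg9Y (Matrix (Fin N) (Fin N) ℂ) (specialUnitaryUnits (Fin N)) x).Reg335 c35Y α₀ U → (bg9Y (Matrix (Fin N) (Fin N) ℂ) (specialUnitaryUnits (Fin N)) x).Reg336 c35Y α₀ U →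
        Clause342 ((opsYOfLetters N θ.toStage3Params Mstar 𝔏 𝔈) x).GG 1 B12₁ δ12₁ U ∧ L2Block ((opsYOfLetters N θ.toStage3Params Mstar 𝔏 𝔈) x).GG B12₁ δ12₁ U ∧
          (∀ (n : Fin 4) (lam : (geo9Y x).Loc) (γ : ℝ), n ≠ 3 → -4 ≤ γ → γ ≤ 4 →
            (((opsYOfLetters N θ.toStage3Params Mstar 𝔏 𝔈) x).GG).glob n U lam γ ≤ B12₁ * (geo9Y x).wNorm γ lam) ∧
          B9.Ineq343_345 ((opsYOfLetters N θ.toStage3Params Mstar 𝔏 𝔈) x).GG Bβ12 Bε12 Bεβ12 δ12₁ U)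
    (hdict : ∀ x : MemberY θ.d₆ θ.ℓ₆ θ.hd' θ.hL' θ.b₀ θ.b₁ Mstar, Dict349 ((opsYOfLetters N θ.toStage3Params Mstar 𝔏 𝔈) x).Gp ((opsYOfLetters N θ.toStage3Params Mstar 𝔏 𝔈) x).Cinv ((opsYOfLetters N θ.toStage3Params Mstar 𝔏 𝔈) x).P349)
    (P : B12.RunParams) : Dag.B9_main (leavesP w P) := by
  have hL1 : (1 : ℝ) ≤ ((θ.ℓ₆ + 1 : ℕ) : ℝ) := by exact_mod_cast Nat.succ_le_succ (Nat.zero_le _)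
  have t311 := t311_of_pin θ.toStage3Params Mstar (opsYOfLetters N θ.toStage3Params Mstar 𝔏 𝔈) 𝔬311 θ311 a311 M311 ha311 hM311 h311 hPD
  have t315 := t315_of_pins θ.toStage3Params Mstar (opsYOfLetters N θ.toStage3Params Mstar 𝔏 𝔈) 𝔬315 hK5 hm5 ha5 hδ5 hB5 hR5 hS5 h315 hG315 hH315
  have hGp := hGp_opsYOfLetters_of_leaves5 N θ.toStage3Params Mstar 𝔏 𝔈 hGpL3 hGpL4 hGpL5 hGpE4 hGpH2
  have hGA := hGA_opsYOfLetters N θ.toStage3Params Mstar 𝔏 𝔈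
  obtain ⟨t39, hksum⟩ := t39_hksum_of_pin_rowConst261 (opsYOfLetters N θ.toStage3Params Mstar 𝔏 𝔈) 𝔬39 rd39 (θ.d₆ + 1) α39 α' r39 δ39 θ39 B39 N39 a39 M39 c35Y_pos h39α h39α1 hα'0
    hα'1 hr39 hrδ39 hθ39 hB39 hN39 ha39 hM39 hst39 hloc39 h39 hEK39 hrdC
  have s3132 := s3132_of_inputs θ.toStage3Params Mstar (opsYOfLetters N θ.toStage3Params Mstar 𝔏 𝔈) hCT hCT₁ hN32 hN32₁ hA32 hwt
  have hgeoOK : ∀ x : MemberY θ.d₆ θ.ℓ₆ θ.hd' θ.hL' θ.b₀ θ.b₁ Mstar, GeoOK (geo9Y x) := fun x => ⟨geo9Y_dist_triangle x, geo9Y_dist_comm x, geo9K_dist_nonneg x.toKIdx, geo9Y_len_pos x⟩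
  obtain ⟨ML12, c12, hrow12⟩ := rowSum261_geo9Y (d := θ.d₆) (ℓ := θ.ℓ₆) (hd := θ.hd') (hL := θ.hL') (b₀ := θ.b₀) (b₁ := θ.b₁) (Mstar := Mstar) σ12 hσ12
  have hrow : ∀ x : MemberY θ.d₆ θ.ℓ₆ θ.hd' θ.hL' θ.b₀ θ.b₁ Mstar, ML12 ≤ (geo9Y x).M → RowSum (toB6 (geo9Y x) (R12 x) (H12 x)) σ12 (max c12 0) := fun x hM y => (hrow12 x hM y).trans (le_max_left _ _)
  have hE : (fun x => ((opsYOfLetters N θ.toStage3Params Mstar 𝔏 𝔈) x).HasRWExp) = fun x => HasRWExpOfOps (𝔬12 x) := funext hpinE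
  have hH : (fun x => ((opsYOfLetters N θ.toStage3Params Mstar 𝔏 𝔈) x).HasRWExpH) = fun x => HasRWExpHOfOps (𝔬12 x) := funext hpinH
  have hK' : (fun x => ((opsYOfLetters N θ.toStage3Params Mstar 𝔏 𝔈) x).PosDefK) = fun x => PosDefKOfOps (𝔬12 x) := funext hpinK
  have t312 : B9.Thm312Printed (θ.d₆ + 1) c35Y geo9Y (bg9Y (Matrix (Fin N) (Fin N) ℂ) (specialUnitaryUnits (Fin N))) (fun x => ((opsYOfLetters N θ.toStage3Params Mstar 𝔏 𝔈) x).GD) (fun x => ((opsYOfLetters N θ.toStage3Params Mstar 𝔏 𝔈) x).G₁)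
      (fun x => ((opsYOfLetters N θ.toStage3Params Mstar 𝔏 𝔈) x).H) (fun x => ((opsYOfLetters N θ.toStage3Params Mstar 𝔏 𝔈) x).H₁) (fun x => ((opsYOfLetters N θ.toStage3Params Mstar 𝔏 𝔈) x).HasRWExp) (fun x => ((opsYOfLetters N θ.toStage3Params Mstar 𝔏 𝔈) x).HasRWExpH)
      (fun x => ((opsYOfLetters N θ.toStage3Params Mstar 𝔏 𝔈) x).PosDefK) := by
    rw [hE, hH, hK']
    exact thm312Printed_of_step 𝔬12 R12 H12 (fun x => ((opsYOfLetters N θ.toStage3Params Mstar 𝔏 𝔈) x).GD) (fun x => ((opsYOfLetters N θ.toStage3Params Mstar 𝔏 𝔈) x).G₁) (fun x => ((opsYOfLetters N θ.toStage3Params Mstar 𝔏 𝔈) x).H)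
      (fun x => ((opsYOfLetters N θ.toStage3Params Mstar 𝔏 𝔈) x).H₁) ev12 evY12 θ12 r12 B12₀ δ12₀ δK12 σ12 (max c12 0) ρ12 a12 M12 ML12 B12₁ δ12₁ Bβ12 Bε12 Bεβ12 hθ12 hr12 hB12₀ hρ12 hρS12
      hρδ12 (le_max_right _ _) ha12 hM12 hB12₁ hδ12₁ hBβ12 hBε12 hBεβ12 hgeoOK (fun x => modelSignsOn_geo9K x.toKIdx) hrow hco12 hmodel12 hres12
  have t313 : B9.Thm313Printed c35Y geo9Y (bg9Y (Matrix (Fin N) (Fin N) ℂ) (specialUnitaryUnits (Fin N))) (fun x => ((opsYOfLetters N θ.toStage3Params Mstar 𝔏 𝔈) x).GG) (fun x => ((opsYOfLetters N θ.toStage3Params Mstar 𝔏 𝔈) x).HasRWExp) (fun x => ((opsYOfLetters N θ.toStage3Params Mstar 𝔏 𝔈) x).PosDefK) := by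
    rw [hE, hK']
    exact thm313Printed_of_step 𝔬12 R12 H12 (fun x => ((opsYOfLetters N θ.toStage3Params Mstar 𝔏 𝔈) x).GG) ev12 evY12 θ12 r12 B12₀ δ12₀ δK12 σ12 (max c12 0) ρ12 a12 M12 ML12 B12₁ δ12₁ B13
      δ13 ρ13 Bβ12 Bε12 Bεβ12 hθ12 hr12 hB12₀ hB13 hσ12.le hρ13 hρ13ρ hρS12 hρδ13 hρδ12 (le_max_right _ _) ha12 hM12 hB12₁ hδ12₁ hBβ12 hBε12 hBεβ12 hgeoOK
      (fun x => modelSignsOn_geo9K x.toKIdx) hrow hco13 hmodel12 hletters13 hres13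
  have hE4 := hE4_of_hGA_e4 (opsYOfLetters N θ.toStage3Params Mstar 𝔏 𝔈) (hGA_e4_opsYOfLetters N θ.toStage3Params Mstar 𝔏 𝔈)
  have hH2 := hH2_of_hGA_h2 (opsYOfLetters N θ.toStage3Params Mstar 𝔏 𝔈) (hGA_h2_opsYOfLetters N θ.toStage3Params Mstar 𝔏 𝔈)
  have hg := hg_obligation_vacuous θ.toStage3Params Mstar (opsYOfLetters N θ.toStage3Params Mstar 𝔏 𝔈)
  have t37 := t37_of_allPin_complete θ.toStage3Params Mstar (opsYOfLetters N θ.toStage3Params Mstar 𝔏 𝔈) 𝔬 rd 𝔭 SH SL SI S2 Bl BV BI θI BI2 NH NL BL MF NI N2 B2 θ2 dL R H κ d α ρ Nc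
    N' Cℓ K θ₀ B₀ δ₀ a₁ M₁ ML bH hα hα2 hN hN' hCℓ hK0 hB₀.le hδ₀.le ha₁ hM₁ hNH hNL hBL hNI hN2 hB2 hθ2 hst hκ h261 h36 h36H hcntH hcntL hcntI hcnt2 hBl hBV hBI hBI2 hθI
    (fun x => (rd x).ev) evY hco0 hco1 hco2 hco3 hgl0 hgl1 hgl2 hgl3 hl0 hl1 hl2 hl3 hl4 hl5 hH1 hIR hsym htr hadjL hfacts hCB hCL hδ₁le hαF hαF2 hCg hBβ hBL5 hfacts₀ hBεP hBεβP
    hB4P hE37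
  have hα1 : α < 1 := by linarith
  have c38 := c38_of_allPin θ.toStage3Params Mstar (opsYOfLetters N θ.toStage3Params Mstar 𝔏 𝔈) 𝔬 rd R H κ d α ρ Nc N' Cℓ K θ₀ B₀ δ₀ a₁ M₁ ML hα hα1 hθ₀ hB₀ hδ₀ ha₁ hM₁ hst hκ hrd hloc h261 h36 hE37
  have t310 := t310_of_allPin_complete θ.toStage3Params Mstar (opsYOfLetters N θ.toStage3Params Mstar 𝔏 𝔈) 𝔬310 rd310 𝔭3 SH3 SL3 SI3 S23 Bl3 θH3 BI3 θI3 BI23 NH3 NL3 BL3 MF3 NI3 N23 B23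
    θ23 dL3 R310 H310 κ310 bH3 d3 α3 ρ3 N3 N3' NF3 Cℓ3 K3 θ3 B3 δ3 a3 M3 ML3 hα3 hα3' hN3 hN3' hNF3 hCℓ3 hK3 hθ3 hB3 hδ3 ha3 hM3 hNH3 hNL3 hBL3 hNI3 hN23 hB23 hθ23 hst3 hκ3 hrd3
    hloc3 h261_3 h36_3 h36H3 hcntH3 hcntL3 hcntI3 hcnt23 hBl3 hθH3 hBI3 hBI23 hθI3 ev3 evY3 hcoA0 hcoA1 hcoA2 hcoA3 hglA0 hglA1 hglA2 hglA3 hlA0 hlA1 hlA2 hlA3 hlA4 hlA5 hH13 hIR3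
    hsymA htrA hadjLA hfactsA hCB3 hCL3 hδ₁le3 hαFA hαFA2 hCg3 hBβ3 hB53 hfactsA₀ hBε3 hBεβ3 hB43 hE310
  have hsum := hsum_of_allPins θ.toStage3Params Mstar (opsYOfLetters N θ.toStage3Params Mstar 𝔏 𝔈) 𝔬 rd R H (const37 d δ₀ α ρ B₀ Nc N' Cℓ K) ((1 - 2 * α) * δ₀) 𝔬310 rd310 R310 H310 (const37 d3 δ3 α3 ρ3 B3 N3 N3' Cℓ3 K3) ((1 - 2 * α3) * δ3) Bβ Bε Bεβ hB₁ hδ₁ hE37 hE310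
  obtain ⟨t314, t314loc⟩ := thm314_pair_of_pair_walks (c35 := c35Y) (geo := geo9Y) (bg := bg9Y (Matrix (Fin N) (Fin N) ℂ) (specialUnitaryUnits (Fin N)))
    (Kdiff := fun x => ((opsYOfLetters N θ.toStage3Params Mstar 𝔏 𝔈) x).Kdiff) (OmK := OmKY) (dOmega := dOmegaY)
    (fun x => locDataY x (E₁ x) (X₁ x) (Meets₁ x) (diam x)) X₂ Meets₂ (fun x => locDataY_laws x (E₁ x) (near₁ x) (first_mem₁ x) (chain₁ x))
    (fun x => locDataY_laws x (E₂ x) (near₂ x) (first_mem₂ x) (chain₂ x)) r₀ hr (fun x => modelSignsOn_geo9K x.toKIdx) dOmegaY_nonneg h₁ h₂ W₁ W₂ hW₁ hW₂ hcnt₁ hcnt₂ hdom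
  have h31 := B9.thm31_of_thm37 c35Y geo9Y (bg9Y (Matrix (Fin N) (Fin N) ℂ) (specialUnitaryUnits (Fin N))) (fun x => ((opsYOfLetters N θ.toStage3Params Mstar 𝔏 𝔈) x).E37) (fun x => ((opsYOfLetters N θ.toStage3Params Mstar 𝔏 𝔈) x).E310) (fun x => ((opsYOfLetters N θ.toStage3Params Mstar 𝔏 𝔈) x).Gp)
    (fun x => ((opsYOfLetters N θ.toStage3Params Mstar 𝔏 𝔈) x).GA) t37 hsum
  have h32 := B9.thm32_of_thm39 (θ.d₆ + 1) c35Y geo9Y (bg9Y (Matrix (Fin N) (Fin N) ℂ) (specialUnitaryUnits (Fin N))) (fun x => ((opsYOfLetters N θ.toStage3Params Mstar 𝔏 𝔈) x).EK39) (fun x => ((opsYOfLetters N θ.toStage3Params Mstar 𝔏 𝔈) x).Cinv) t39 hksum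
  have h33 := B9.thm33_of_thm37_310 c35Y geo9Y (bg9Y (Matrix (Fin N) (Fin N) ℂ) (specialUnitaryUnits (Fin N))) (fun x => ((opsYOfLetters N θ.toStage3Params Mstar 𝔏 𝔈) x).E37) (fun x => ((opsYOfLetters N θ.toStage3Params Mstar 𝔏 𝔈) x).E310) (fun x => ((opsYOfLetters N θ.toStage3Params Mstar 𝔏 𝔈) x).Gp)
    (fun x => ((opsYOfLetters N θ.toStage3Params Mstar 𝔏 𝔈) x).GA) t37 t310 hsum
  -- the implicit carriers are given explicitly (unification from `S` first is a `whnf` time-out otherwise)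
  have hLp' := stepL2Pos_of_members (d := θ.d₆ + 1) (c35 := c35Y) (geo := geo9Y) (bg := bg9Y (Matrix (Fin N) (Fin N) ℂ) (specialUnitaryUnits (Fin N))) (Gp := fun x => ((opsYOfLetters N θ.toStage3Params Mstar 𝔏 𝔈) x).Gp)
    (GA := fun x => ((opsYOfLetters N θ.toStage3Params Mstar 𝔏 𝔈) x).GA) (Cinv := fun x => ((opsYOfLetters N θ.toStage3Params Mstar 𝔏 𝔈) x).Cinv) (P := fun _ lam => lam.isRight = true) (fun x => modelSignsOn_geo9K x.toKIdx) hLp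
  have hLa' := stepL2Pos_of_members (d := θ.d₆ + 1) (c35 := c35Y) (geo := geo9Y) (bg := bg9Y (Matrix (Fin N) (Fin N) ℂ) (specialUnitaryUnits (Fin N))) (Gp := fun x => ((opsYOfLetters N θ.toStage3Params Mstar 𝔏 𝔈) x).Gp)
    (GA := fun x => ((opsYOfLetters N θ.toStage3Params Mstar 𝔏 𝔈) x).GA) (Cinv := fun x => ((opsYOfLetters N θ.toStage3Params Mstar 𝔏 𝔈) x).Cinv) (P := fun _ lam => lam.isRight = true) (fun x => modelSignsOn_geo9K x.toKIdx) hLa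
  have hA := stepAnalyticPos_of_halves (d := θ.d₆ + 1) (c35 := c35Y) (geo := geo9Y) (bg := bg9Y (Matrix (Fin N) (Fin N) ℂ) (specialUnitaryUnits (Fin N))) (Gp := fun x => ((opsYOfLetters N θ.toStage3Params Mstar 𝔏 𝔈) x).Gp)
    (GA := fun x => ((opsYOfLetters N θ.toStage3Params Mstar 𝔏 𝔈) x).GA) (Cinv := fun x => ((opsYOfLetters N θ.toStage3Params Mstar 𝔏 𝔈) x).Cinv) (IsAnalyticExt := fun x => ((opsYOfLetters N θ.toStage3Params Mstar 𝔏 𝔈) x).IsAnalyticExt) hAp hAa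
  have hB := sectBStepPrinted_of_posBlockSteps (d := θ.d₆ + 1) (c35 := c35Y) (geo := geo9Y) (bg := bg9Y (Matrix (Fin N) (Fin N) ℂ) (specialUnitaryUnits (Fin N))) (Gp := fun x => ((opsYOfLetters N θ.toStage3Params Mstar 𝔏 𝔈) x).Gp)
    (GA := fun x => ((opsYOfLetters N θ.toStage3Params Mstar 𝔏 𝔈) x).GA) (Cinv := fun x => ((opsYOfLetters N θ.toStage3Params Mstar 𝔏 𝔈) x).Cinv)
    (IsAnalyticExt := fun x => ((opsYOfLetters N θ.toStage3Params Mstar 𝔏 𝔈) x).IsAnalyticExt) (P := fun _ lam => lam.isRight = true) (fun x => modelSignsOn_geo9K x.toKIdx) h32 h33 hA hEp hLp' hGlp hH1p hE4p hH2p hK hEa hLa' hGla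
    hH1a hE4a hH2a
  have s349 : B9.Stmt349Printed (θ.d₆ + 1) c35Y geo9Y (bg9Y (Matrix (Fin N) (Fin N) ℂ) (specialUnitaryUnits (Fin N))) (fun x => ((opsYOfLetters N θ.toStage3Params Mstar 𝔏 𝔈) x).P349) :=
    stmt349Printed_of_thm31_thm32 (geo := geo9Y) (bg := (bg9Y (Matrix (Fin N) (Fin N) ℂ) (specialUnitaryUnits (Fin N)))) (θ.d₆ + 1) h31 h32 (Q := fun _ lam => lam.isRight = true)
      (fun x => modelSignsOn_geo9K x.toKIdx) (fun x => distOK_geo9Y x) hL1 (fun _ => rfl) one_pos levelGap_geo9Y_one rowSum261_geo9Y hdict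
  exact b9_main_of_up_view₁₁B10YZW_of_obligations θ hθ Mstar (opsYOfLetters N θ.toStage3Params Mstar 𝔏 𝔈) ζ lamW w hup (hGp_e_opsYOfLetters N θ.toStage3Params Mstar 𝔏 𝔈) (hGp_h1_opsYOfLetters N θ.toStage3Params Mstar 𝔏 𝔈)
    (hC_opsYOfLetters N θ.toStage3Params Mstar 𝔏 𝔈) (hGA_e_opsYOfLetters N θ.toStage3Params Mstar 𝔏 𝔈) (hGA_h1_opsYOfLetters N θ.toStage3Params Mstar 𝔏 𝔈) (hGA_e4_opsYOfLetters N θ.toStage3Params Mstar 𝔏 𝔈)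
    (hGA_h2_opsYOfLetters N θ.toStage3Params Mstar 𝔏 𝔈) (hGA_l2_opsYOfLetters N θ.toStage3Params Mstar 𝔏 𝔈) hE4 hH2 hGp hGA hB hg t37 c38 t39 t310 hsum hksum t311 t312 t313 t314 t315 s349 s3132 t314loc P

end Pointed

end Summit.QuantumFields.YangMills.BalabanUVNodes.N06AtOpsYOfLettersAllPinsD

end
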